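import Mathlib
import HarnessLib
import HarnessLib.Audit
import Summits.QuantumFields.Statement
import Literature.MathematicalPhysics.QuantumLattice.WilsonCellSchur
import Literature.MathematicalPhysics.QuantumFieldTheory.QuasiLocalGaugePerturbation
import HarnessLib.Audit.Status.Attr

/-!
Route: NestedDissectionSea

DORMANT since 2026-08-24T21:48:41Z (reconciler: no traction for 7.1 d (last activity item-evidence-added at 2026-08-17T18:51:48Z); parked, not closed — `ledger route dormant route-QuantumFields-NestedDissectionSea --off` to reactivate) — unstaffed, not closed; items shared with open routes are served there. `ledger route dormant <id> --off` reactivates.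

# Route NestedDissectionSea — nested-dissection Schur factorisation of the Wilson sea — early
crossers are mesoscopic large deviations, so the exactly local sign spins are window-dilute and the
separators coercive; with RG-level robust SU(3) Yang–Mills this feeds a bosonic RG at every positive
quark mass, and the zero-threshold parity-jump pin makes the regularisation chiral at zero

It suffices to show X = EarlyCrosserLaw ∧ FrameAndSeparatorLaw ∧ SeaFactorisationBridge ∧
LightQuarkCompletion, given the shared named condition RobustYangMillsRG (card
nested-dissection-sea, spine; REPAIRED 2026-08-17 on the crux-attack rattack-18065 — the bridge now
consumes FRAMED, BY-NAME hypotheses: THE LINE hands over its own regularisation and the new ∀reg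
crux FrameAndSeparatorLaw frames it (two-sided pin ⇒ m_crit → 0) and makes its separators coercive,
replacing the unframed ∃reg hinge as bridge input; REPAIRED 2026-08-17 on the crux-attack
rattack-17705 — bridge in THRESHOLD form + a named light-quark node split into zero-threshold
descent and chirality of the jump line; RE-TYPED 2026-08-16 after the `QCDOf` re-type
`IsChiralAtZero` (p117723): zero threshold, two-sided parity-jump pin, chiral crux, RG-level
Yang–Mills input; restated 2026-08-15 over the landed `WilsonCellSchur` vocabulary with explicit
Yang–Mills input; sharpened 2026-08-15 (g2) by the parity-free EARLY-CROSSER LAW as the line on the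
dilution clause). Object: the Wilson determinant of the statement's own scheme (SU(3), r = 1,
signed, N_f = 2, 3) on the odd tori (ℤ/(2S+1))⁴, factorised EXACTLY along a nested-dissection
hierarchy of open boxes (children by floor/ceil halving, one-site sheets as separators): det D_W =
∏_(scale, box) det S_Σ(box), S_Σ = Schur complement of the Dirichlet cell matrix onto its internal
separator = d(box)/∏ d(children) (SchurCellStep), every factor a rational function of the links
INSIDE the box and REAL (DirichletDetReal), so sign det D_W = ∏ local cell signs, and the sign of a
cell at bare mass μ is exactly the parity of the number of REAL-EIGENVALUE CROSSINGS ABOVE μ of its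
massless Dirichlet Wilson operator (real monic polynomial in μ; SignDefectForcesCrossing). SEA LAWS.
CoerciveSea (stmt-13901, rank 3; since the 2026-08-17 frame repair the BY-NAME CONJUNCTION NODE
13900 ∧ 14759, kernel-checked, parked by its lead — its ∃reg carries no branch clause and no upper
pin, so it is no longer bridge input): along ONE mass-independent asymptotically scaling,
mass-scaling regularisation, for all mass tuples above a threshold M₀ and on EVERY odd torus of
physical side ≥ R (all volumes): (i) SEPARATOR WEGNER LAW IN THE WINDOW — for roughly cubic corner-0
boxes with b₀ ≤ s_i, s_i a_k ≤ ℓ the phase-quenched probability of a (t/s₀)-singular separator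
(HasSingularSeparator) is ≤ C t^α, uniformly in k, volume, box; (ii) WINDOWED LOCAL DILUTION — the
probability that a corner-0 box at dyadic scale j inside the window is a sign defect (IsSignDefect)
is ≤ δ_j with Σ_j δ_j ≤ ε eventually in k (= NegativeCellsDilute (a), stmt-13900, the tier-deciding
crux); (iii) PARITY PIN — a physical distance M below m_crit(k) the torus determinant is negative
with probability ≥ 1/4 already on tori of FIXED physical size ≥ R (= NegativeCellsDilute (b): pins
m_crit to the chiral critical line within a_k M₀/Z_m; kills m_crit ≡ 0 / volume-inflation and
deep-supercritical witnesses). FrameAndSeparatorLaw (crux, rank 3, NEW 2026-08-17 — the frame the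
bridge was missing, BY NAME, and the ∀-aligned item form of (i)/CoerciveOfDilute the CoerciveSea
leads asked for): for EVERY admissible regularisation, (α) FRAME — if above a threshold the
determinant sign on physical tori is pinned FROM BOTH SIDES ((b),(b″) below) then m_crit(k) → 0 (a
sharp two-sided parity jump can only sit at the physical critical line: doubler clusters have even
multiplicities 4, 6, 4, between lines P(Re det<0) ≈ P(Q odd) is flat, m_c(β) → 0), and (β) SEPARATOR
WEGNER LAW ON LARGE WINDOW BOXES along every physical-branch regularisation carrying (ii),(iii) —
VERBATIM the registered stub_separatorLawLarge of 13901's built line (sub-window ℓ′ ≤ ℓ, sides ≥ S₀;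
small boxes are deterministic by KineticEdge). THE LINE ON (ii): EarlyCrosserLaw (crux, rank 2,
stmt-13995) — same prefix, the pin made TWO-SIDED ((b) and its upper companion (b″): a distance M >
M₀ above the line P(Re det < 0) ≤ 1/8 on tori of physical side in [R, 2R]), and for every window box
the phase-quenched (outer) probability that the box OR ONE OF ITS 16 CHILDREN IS SINGULAR AT SOME
BARE MASS ≥ A VALENCE MASS (a real-eigenvalue crossing at or above the valence mass = an early
crosser sits in the cell) is ≤ δ_j, δ_j ≥ 0, Σ_j δ_j ≤ ε; EarlyCrosserLaw → SignDefectForcesCrossing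
→ NegativeCellsDilute is pure logic (term-checked; the former support DiluteOfEarlyCrossers).
SeaFactorisationBridge (rank 5, RESTATED 2026-08-17 twice: in THRESHOLD form on rattack-17705 —
RobustYangMillsRG's format (∃β₀ before ∀ℓ₀, NormLE κ B₀) is consumable only for quarks heavy in
block units — and over FRAMED BY-NAME HYPOTHESES on rattack-18065 — the unframed ∃reg hinge could
not carry the framed conclusion (Death 1, hinge idle): RobustYangMillsRG → EarlyCrosserLaw →
FrameAndSeparatorLaw → for N_f = 2, 3 ONE admissible regularisation (HasMassScaling,
HasAsymptoticScaling; physical branch in the weak sense m_crit(k) ≥ −1 eventually — now a projection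
of (α)), a THRESHOLD M₀ ≥ 0, the parity-jump line of the Wilson determinant located from both sides
ABOVE THRESHOLD (EarlyCrosserLaw (b),(b″) for M > M₀: eventually in k, P(Re det D_W(m_crit −
a_kM/Z_m) < 0) ≥ 1/4 on odd tori of side ≥ R and P(Re det D_W(m_crit + a_kM/Z_m) < 0) ≤ 1/8 on odd
tori of side in [R, 2R]) and the QCDOf body — IsQCDAlong OS data, non-trivial non-Gaussian glue,
non-decoupled flavour-changing pseudoscalars, one Δ > 0 for T.HasMassGap and HasLatticeMassGap — at
every tuple m > M₀ (block scale ℓ₀ = c/M₀; the shape the sibling's ThresholdQCD has).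
LightQuarkCompletion (rank 6, RESTATED 2026-08-17 from JumpLineIsChiral — the named light-range
half): every regularisation #5 outputs admits one (intended: re-pinned at its own parity-jump line,
along a subsequence) on the physical branch (m_crit(k) → 0), pinned at ZERO threshold from both
sides, carrying the QCDOf body at EVERY positive tuple and chiral at zero (reg.IsChiralAtZero) — the
witness of the re-typed QCDOf; its glued split (glue pure logic) is ZeroThresholdDescent (the jump
band sharpens to o(a_k/Z_m) and the body continues below the threshold scale: IR/chiral-regime
completion, the UV being the hypothesis') → JumpLineIsChiral (verbatim the rev-26 statement: every
admissible branch regularisation pinned at zero threshold is chiral at zero, because the parity-jump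
line is the zero-mode edge of H_W = γ₅D_W on physical volumes, i.e. the Aoki-phase boundary /
first-order line of Wilson χPT where the lattice pion mass vanishes or is O(a) in physical units
(SharpeSingleton1998, Aoki1984WilsonPhase, GoltermanShamirSvetitsky2005), and the chiral limit of
N_f ≥ 2 QCD is gapless (Goldstone pions, GMOR)); closes assembles QCDOf 2 ∧ QCDOf 3 directly.
Mechanism behind the early-crosser law (MECHANISM-g2.md on 13900/13995): a crossing mode at μ' has
Wilson-term energy EXACTLY |μ'| (KineticEdge; EHN-instanton 1998 eq. u†Bu + v†Bv = m), so no cell of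
side < π(2/|μ'|)^{1/2} crosses and carriers are smooth envelopes; a simple real eigenvalue of the
γ₅-hermitian Wilson operator moves by the Hellmann–Feynman law λ' = ⟨w,γ₅W'w⟩/⟨w,γ₅w⟩ with chirality
⟨w,γ₅w⟩ = ±1/(eigenvalue condition number), so robust carriers are CHIRAL topological lumps of size
ρ sitting at m_crit − c_I/ρ² (c_I = 0.75 as ρ → ∞, 1.64 at ρ = 2) whose crossing mass responds at
FIRST order to gluons of wavelength ρ; lifting one to the valence mass m_crit + a_k m/Z_m needs a
deviation of order 1/g(ρ) — probability a power (ρ a_k Λ)^{b'} — and is impossible beyond ρ_* = (c_I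
Z_m/(a_k m))^{1/2} ∝ a_k^{−1/2}; with the UV-convergent dilute-gas density (ρ a_k Λ)^b ρ^{−5} dρ, b
= 11 − 2N_f/3 > 4 (asymptotic freedom), the window sum is ≲ (ℓΛ)⁴ (ρ_* a_k Λ)^{b+b'−4} log(1/a_k) →
0 for every m > 0 with no competition between constants. Pair-collision carriers (chirality ≈ 0) are
the Aoki sector, of WχPT width ∝ a³ ≪ a_k m/Z_m (SharpeSingleton1998); dislocations cross deep below
the line and never carry the sign.
Lean: `EarlyCrosserLaw ∧ FrameAndSeparatorLaw ∧ SeaFactorisationBridge ∧ LightQuarkCompletion`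

## Assembly
Pure logic, term-checked sorry-free (std axioms; planner Sketch.lean rc 0, 2026-08-17) as the
deciding theorem `closes : RobustYangMillsRG → EarlyCrosserLaw → FrameAndSeparatorLaw →
SeaFactorisationBridge → LightQuarkCompletion → QCD` (route-repair 2026-08-17 on rattack-18065;
before it, on rattack-17705 and the `QCDOf` re-type of 2026-08-16): the bridge is fed BY NAME with
the RG-level robust SU(3) Yang–Mills input, THE LINE EarlyCrosserLaw (its own two-sided-pinned,
early-crosser-dilute regularisation) and FrameAndSeparatorLaw ((α) frames that regularisation,
m_crit → 0; (β) makes its separators coercive; (ii) along it is (a′) through the proved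
SignDefectForcesCrossing), and returns for N_f = 2 and N_f = 3 ONE admissible regularisation with a
threshold M₀, the two-sided parity pin above M₀ and the QCDOf body above M₀; LightQuarkCompletion (=
ZeroThresholdDescent ∧ JumpLineIsChiral by its foreseen glue) turns it into a branch regularisation
pinned at zero threshold, chiral at zero and carrying the body at every positive tuple; `QCDOf N_f =
⟨reg′, HasMassScaling, IsChiralAtZero, body⟩`, `QCD = QCDOf 2 ∧ QCDOf 3`. No threshold re-basing by
shifting m_crit (voided by the re-type). CRUX-ONLY: every binder of `closes` is a crux —
RobustYangMillsRG, EarlyCrosserLaw, FrameAndSeparatorLaw, SeaFactorisationBridge,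
LightQuarkCompletion — and every binder is used (`hB hY hE hF`, then LightQuarkCompletion). BY-NAME
LEGACY NODES outside the deciding cone (their texts are types in ~60 landed modules, so they are
kept verbatim and close as corollaries): NegativeCellsDilute (13900) ⇐ EarlyCrosserLaw by the proved
SignDefectForcesCrossing (the dropped pure-logic support DiluteOfEarlyCrossers, re-landable
verbatim); CoerciveSea (13901) ⇔ NegativeCellsDilute ∧ CoerciveOfDilute (proved) and ⇐
PinnedDilutionOnBranch (13900 + branch, = EarlyCrosserLaw + (α) + SignDefectForcesCrossing,
Sketch.lean) + FrameAndSeparatorLaw.2 by the landed composition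
coerciveSea_of_pinnedDilutionOnBranch_of_separatorLawLarge; CoerciveOfDilute (14759, support again)
⇐ CoerciveSea (coerciveOfDilute_of_coerciveSea, landed). SchurCellStep, DirichletDetReal,
SignDefectForcesCrossing, KineticEdge, ChiralityPairing, DiluteOfCoercive are proved; the Assembly
item is `closes` verbatim (`unfold Assembly; exact closes`). Sanity (Sketch.lean rc 0): the rev-29
bridge implies the repaired one (bridgeR_of_bridge — a weakening, as the refuter's C′), and the
repaired hypotheses assemble exactly the framed hinge along ONE regularisation
(pinnedDilutionOnBranch_of_line).

Rationale: WHY THIS LINE. Nested dissection (George1973) orders Gaussian elimination so that separators come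
last; for Grassmann variables block elimination is EXACT integration: iterating the one-level Schur
factorisation that lattice practitioners use numerically (CeGiustiSchaefer2017 §2,
GiustiSaccardi2022; well-conditioned block Dirichlet problems: Luscher2003SchwarzDD; SF gap ∝ 1/T:
Sint1994) over ALL scales turns the non-local signed sea into a product of local, real,
scale-indexed factors: the Fröhlich–Spencer / Feshbach–Schur multiscale architecture
(FrohlichSpencer1983, BachFrohlichSigal1998) transplanted from RESOLVENTS to the fermion DETERMINANT
(elimination tree ↦ RG ladder, fill-in ↦ scale-j effective quark action, pivot breakdown ↦ resonant
box). THE LEVER on the tier-deciding dilution clause (MECHANISM-g2.md on stmt-13900/13995), exact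
part first: (L1) the sign of a Dirichlet cell at bare mass μ is the parity of the number of
real-eigenvalue crossings ABOVE μ (SignDefectForcesCrossing, proved), so the sharp object is the
CROSSING — hence the parity-free crux EarlyCrosserLaw (→ NegativeCellsDilute through the proved
SignDefectForcesCrossing; pure logic, formerly the support DiluteOfEarlyCrossers); (L2) KINETIC EDGE
(KineticEdge, proved): a kernel vector of a Dirichlet Wilson cell at bare mass μ' has Wilson-term
energy EXACTLY |μ'| (EdwardsHellerNarayananInstanton1998 p. 6), bounded below by the free open-box
edge Σ_i(1 − cos(π/s_i)) (diamagnetic inequality): no cubic cell of side < π(2/|μ'|)^{1/2} crosses,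
so carriers near the line are SMOOTH envelopes; (L3) LAW OF MOTION: a simple real eigenvalue λ of
the γ₅-hermitian Wilson family has left eigenvector γ₅w, λ' = ⟨w,γ₅W'w⟩/⟨w,γ₅w⟩ ∈ ℝ and
|⟨w,γ₅w⟩|/‖w‖² = 1/κ(λ) — chirality IS the inverse eigenvalue condition number (ChiralityPairing,
proved; MohlerSchaefer2020 p. 7, TrefethenEmbree2005): real modes are born/annihilated in pairs at
chirality 0, so sign carriers are CHIRAL TOPOLOGICAL LUMPS or fragile PAIR-COLLISION modes (the Aoki
sector), responding at first order to gluons of their own wavelength. Heuristic part (numbers in the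
thesis): (L4) SCALE PINCER — a lump of size ρ sits at m_c − c_I/ρ² and its crossing mass fluctuates
with std ≍ c₁ g(ρ)/ρ² (first order in the RUNNING coupling), so lifting it to the valence mass costs
probability (ρa_kΛ)^{b'} and is impossible beyond ρ_* = (c_I Z_m/(a_k m))^{1/2} ∝ a_k^{−1/2}; (L5)
CONSTANT-FREE DILUTION — against the UV-convergent dilute-gas density C_N(ρa_kΛ)^b ρ^{−5}dρ, b = 11
− 2N_f/3 (Weinberg2012 (10.209)–(10.210); tHooft1976), Σ_{j<J} δ_j ≲ C(ℓΛ)⁴(ρ_* a_kΛ)^{b+b'−4} log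
ρ_* → 0 like a_k^{(b+b'−4)/2} for EVERY m > 0 (margin b − 4 = 5, 17/3): asymptotic freedom at the
small-size end does the work, no rate-vs-entropy competition — so zero threshold is within the
mechanism on the SEA side (the light node #6a), while the BRIDGE's hypotheses bite only above a
threshold (#5). Data: ⟨n_neg⟩ ≈ 2%, 0.3%, 0.05% at β_W = 3.4, 3.55, 3.7 on (≈3 fm)⁴, 'never two'
(MohlerSchaefer2020 pp. 7–8): ∝ a^{≈6.8} reads b' ≈ 9, c₁ ≈ 0.06; GoltermanShamirSvetitsky2005 pp.
9, 14 / GoltermanShamir2003 pp. 3–4 (mobility edge > 0 outside the Aoki phase) frame the valence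
masses as the LOCALISED regime above the edge, and the edge as the chiral line (#6b). Imported
areas: sparse direct solvers, random-Schrödinger multiscale analysis / Lifshitz tails, non-normal
perturbation theory, polymer expansions (KoteckyPreiss1986), weak Gibbsianity
(BricmontKupiainenLefevere1998), convergent-end instanton counting, Wilson χPT
(SharpeSingleton1998). Versus siblings (SpectralDefectExtinction, WilsonMobilityGap/PauliWegnerSea,
IntegerCriticalLine): the sign is an exactly local cell spin flipped only by crossings above the
valence mass, carried by smooth, chiral, size-capped lumps counted by the convergent end of the
instanton measure; the YM-hard part is the shared #4, the light-quark part the named node #6.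

RANKED CRUXES. #2 EarlyCrosserLaw (crux, stmt-QuantumFields-13995; THE LINE on the tier-deciding
clause) — ∃ ONE admissible reg (HasMassScaling, HasAsymptoticScaling), M₀ ≥ 0, b₀ ≥ 2, window ℓ > 0,
∀ m > M₀ ∃ R > 0: (a') windowed dilution of EARLY CROSSERS — for every window box the phase-quenched
outer probability that the box or one of its 16 children is singular at some bare mass ≥ a valence
mass is ≤ δ_j, δ_j ≥ 0, Σ_j δ_j ≤ ε, eventually in k on every odd torus of physical side ≥ R;
(b),(b″) the two-sided PARITY PIN for M > M₀ (thesis). [difficulty: open-problem] (why it might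
fail: pair-collision carriers (chirality → 0) with an Aoki-type band above m_crit shrinking no
faster than the valence offset a_k m/Z_m; the pin fails if index modes cross over a band ≫ a_k
M/Z_m.) [MohlerSchaefer2020, EdwardsHellerNarayananInstanton1998, EdwardsHellerNarayanan1998,
GoltermanShamir2003, GoltermanShamirSvetitsky2005, SharpeSingleton1998, Weinberg2012, tHooft1976,
evidence:stmt-QuantumFields-13900/MECHANISM-g2.md]
#2' NegativeCellsDilute (crux, tier-deciding pointer; stmt-QuantumFields-13900; CONSEQUENCE of #2
via the proved SignDefectForcesCrossing (pure logic, inlined in the interim closes of rev 31 — the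
dropped support DiluteOfEarlyCrossers), PROJECTION of #3 via DiluteOfCoercive; outside the deciding
cone since the frame repair — its ∃reg is unframed — and closing as a corollary of #2) — same
prefix; (a) WINDOWED LOCAL DILUTION — P(corner-0 window box at scale j is a sign defect for some
flavour) ≤ δ_j, Σδ_j ≤ ε; (b) PARITY PIN below the line as in #2. [difficulty: open-problem] (why it
might fail: as #2.) [as #2; BerrutoNarayananNeuberger2000, Adams2003, KoteckyPreiss1986]
#3 CoerciveSea (crux, stmt-QuantumFields-13901; since the frame repair of 2026-08-17 the BY-NAME
CONJUNCTION NODE 13900 ∧ 14759 (coerciveSea_iff_negativeCellsDilute_and_coerciveOfDilute,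
kernel-checked) OUTSIDE the deciding cone — its ∃reg carries no branch clause and no upper pin
(PinWindow.mass_mem_Ioo: certified only into (−8+aM/Z, aM/Z)), so the bridge no longer consumes it;
PARKED by its lead c5: closes by the landed composition
coerciveSea_of_pinnedDilutionOnBranch_of_separatorLawLarge from PinnedDilutionOnBranch (= 13900 +
branch = EarlyCrosserLaw + (α) + SignDefectForcesCrossing, Sketch.lean) and FrameAndSeparatorLaw.2;
kept crux-kind because support items render after the cruxes that name it) — same prefix, ∀ m > M₀ ∃
R: (i) SEPARATOR WEGNER LAW IN THE WINDOW — ∃ C, α > 0, eventually in k, on every odd torus of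
physical side ≥ R, for roughly cubic corner-0 window boxes, every flavour, every t ∈ (0,1]:
P(HasSingularSeparator U m_f(k) s (t/s₀)) ≤ C t^α; (ii),(iii) = #2' (a),(b). [deps:
NegativeCellsDilute] [difficulty: open-problem] (why it might fail: (i): typical lowest separator
singular value ≍ c₁/s; the law needs its gauge-noise fluctuations at scales ≤ ℓ to be large
deviations — false if the window top feels O(1) coupling g²(ℓ) or if non-normal cells
pseudo-resonate without smooth carriers.) [Sint1994, Luscher2003SchwarzDD, CeGiustiSchaefer2017,
Wegner1981DensityOfStates, FrohlichSpencer1983, HernandezJansenLuscher1999, MohlerSchaefer2020]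
#3″ FrameAndSeparatorLaw (crux, NEW 2026-08-17, route-repair on the crux-attack rattack-18065 — the
BY-NAME carrier of the frame the bridge was missing, and the ∀-aligned item form of #3 (i) / #3′
that the CoerciveSea leads c2–c5 asked the planner to file; a top-level decl because `--split
CoerciveSea` into PinnedDilutionOnBranch + this was refused to this seat (final-cycle-only rule) and
13901/14759's texts are frozen by landed modules) — for EVERY admissible regularisation reg (HMS,
HAS) of N_f ∈ {2,3}: (α) FRAME — if above some M₀ ≥ 0 the determinant sign is pinned from BOTH sides
on physical tori along reg (∀ m > M₀ ∃ R: (b) ∧ (b″) of #2 under one eventuality) then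
Filter.Tendsto reg.mcrit atTop (nhds 0): a sharp two-sided jump of P(Re det < 0) across a band of
vanishing lattice width can only sit at the upper edge of the physical real-mode cluster, m_c(β_k) +
o(1) → 0 — between critical lines P(Re det(μ) < 0) = P(odd number of real Wilson modes below −μ) ≈
P(Q odd) is flat in μ, the doubler clusters at Wilson mass 2, 4, 6 have EVEN multiplicities 4, 6, 4
and never flip the parity, abundant small carriers drive P(odd) to 1/2 but never back below 1/8, and
m_c(β) → 0 (the χ_t>0 / index-parity LOWER-bound input rattack-18065 located 'in neither
hypothesis': WindowDefectFloorIffBranch, PinUpperBranch p93744); (β) SEPARATOR WEGNER LAW ON LARGE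
WINDOW BOXES — VERBATIM the registered stub_separatorLawLarge of #3's built line
chirality-collapses-pseudospectrum (hL of the landed composition; ≡ the propagator law p111601 up to
a null disjunct): along every physical-branch reg carrying (ii),(iii) above M₀ at (b₀, ℓ) there are
M₁ ≥ M₀, ℓ′ ∈ (0, ℓ] with, for every m > M₁, some R, S₀, C, α > 0: eventually in k, on odd tori of
side ≥ R, for roughly cubic boxes with b₀ ≤ s_i ≤ N, s_i a_k ≤ ℓ′, s_i ≥ S₀, every flavour, every t
∈ (0,1], P_pq(HasSingularSeparator U m_f(k) s (t/s₀)) ≤ C t^α (small boxes deterministic: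
KineticEdge, smallBox_separatorLaw). Role: with #2 and the proved SignDefectForcesCrossing, (α),(β)
assemble exactly the framed hinge along ONE reg (Sketch.lean pinnedDilutionOnBranch_of_line).
[difficulty: open-problem — (β) is the research content of #3/#3′ ('STUCK: no estimate of any
pq-expectation of a spectral/propagator event of D_W at asymptotically free β', lead c5); (α) needs
constructive topological-susceptibility / index-parity control] (why it might fail: (α) only if a
two-sided jump can sit ≳ 1 below the physical line (abundant lattice-scale dislocations re-dipping
P(Re det<0) below 1/8) or on a doubler line, or m_c(β) ↛ 0; (β) as #3 (i).)
[EdwardsHellerNarayanan1998, HasenfratzLalienaNiedermayer1998, Luscher1982Topology,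
Aoki1984WilsonPhase, MohlerSchaefer2020, Wegner1981DensityOfStates, FrohlichSpencer1983, Sint1994,
Luscher2003SchwarzDD, GoltermanShamir2003]
#4 RobustYangMillsRG (crux, rev 3 = stmt-QuantumFields-17812, SHARED verbatim with
HeavyThresholdYMBridge and staffed once YM-side — route-repair 2026-08-17 after the LANDED
refutation `Summit.QuantumFields.QCD.Theorems.not_RobustYangMillsRG` of rev 2 = stmt-14958,
refuted-misstated: rev 2 tied the principal part to the fibre infimum A_Bl of an ∃-chosen blocking
fenced only by measurability + cor-covariance + 5b-locality, so the WILD measurable blocking —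
straight transport × X^n ζ^j, exponents decoded from a dial plaquette — pushed Haar to Haar with
fibre infimum ≡ 0 and made the β = 0 Haar weight admissible for every β₀ (tree no-go
not_isNontrivial_beta_zero). Both repair seats filed a rev 3 within six minutes; this route first
filed its own (stmt-18010: continuous cA-coercive blocking, fibre-infimum principal part, E1-less
FINE package, bundled over BalabanFormatDensity; machine checks admAt_iff / rev3b_iff_rev3 /
rev3b_of_rev2 kept as evidence on 18010/14958) and then ADOPTED the sibling's text 1:1 so that the
named YM-side condition stays ONE item — on the merits the better statement: (1) PRINCIPAL PART = an
abstract gauge-invariant quasi-local polymer functional A with analytic/real weighted norms ≤ A₀,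
range control and explicit COERCIVITY cA·Σ_p(3 − Re tr V_p) ≤ A(V) − A(𝟙) (new format constants cA,
A₀, ∀-quantified before ∃β₀) — the lead's 'IsPrincipal class' repair: every fibre-infimum / X^n /
thin-decimation / Haar device dies on βe·cA·ε ≫ B₀, and provers get an analytic principal action;
the blocking Bl is a parameter (measurable, cor-covariant, 5b-local), the weights w are gauge
invariant, lattice symmetric, reflection positive and block exactly into exp(−βe·A − W)·F(LF_ε, ·)
with the O(B₀) analytic quasi-local range-controlled remainder W and the rough-region set-function F
as before; (2) CONCLUSION BLOCK-LEVEL — one Δ > 0 with uniform time-slab exponential clustering of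
the blocked laws, |E_w[G₁(V)G₂(τ_tV)] − E_w[G₁(V)]E_w[G₂(τ_tV)]| ≤ C‖G₁‖∞‖G₂‖∞e^{−Δℓ₀t}, V = Bl U,
for all bounded measurable block observables in a slab of thickness h, eventually in k, all S ≥ L_k,
2t ≤ M — exactly the crux-ideate recommendation (FINDINGS-r1-k1 A4 sub-ℓ₀ blindness / A5 E1
dichotomy, FINDINGS-ideator2 F-E1 / F-POS): nothing fine-level, no OS limit, no rotations, no
non-Gaussianity is claimed for a class controlled only through its blocked laws, and block
observables are immune to the signed-weight L¹-ratio issue. Physics: every RP hypercubic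
gauge-invariant lattice gauge theory weakly coupled at scale ℓ₀ in the coercive Bałaban format has a
volume-uniform gap (universality/openness of the gapped SU(3) phase). It is the consumable
Yang–Mills input of the bridge; the FIBRE physics (fine clustering, OS limit, E1, non-triviality) is
now the bridge's, see #5. [difficulty: open-problem ⊇ volume-uniform gap of every weakly coupled
coercive-format SU(3) block theory; g-uniform (ε, r) vs Bałaban's shrinking domains; class empty
unless a fat coercive averaging is certified into the format] [Balaban1988Convergent,
Balaban1985Averaging, Balaban1984Propagators, Balaban1989LargeFieldII, Dimock2022QED3,
DobrushinShlosman1987, FriedliVelenik2017, HasenfratzNiedermayer1993, OsterwalderSeilerAnnPhys1978,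
JaffeWitten2000, evidence:stmt-QuantumFields-18010/RobustYangMillsRG-rev3-filed.md]
#5 SeaFactorisationBridge (crux; RESTATED 2026-08-17 on rattack-18065 — refuted-misstated 'missing
frame on hypothesis 2': the conclusion demands a framed output reg (eventually m_crit ≥ −1,
two-sided pin) but the hinge CoerciveSea is an ∃reg certified only into (−8+aM/Z, aM/Z)
(PinWindow.mass_mem_Ioo, PinUpperBranch p93744, RegPrefixOffBranch p73529,
WindowDefectFloorIffBranch), so any proof had to derive reg_C's frame (a YM-grade converse sea lemma
in neither hypothesis) or discard reg_C (hinge idle ⇒ crux ⊇ the whole sea side) — Death 1 of all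
three 13880 lines; the refuter's C′ framed hypothesis 2; since 13901's text is frozen by landed
modules, the frame is supplied BY NAME instead: hypotheses RobustYangMillsRG, EarlyCrosserLaw (#2 —
the only decl carrying the two-sided pin; ITS reg is the output reg) and FrameAndSeparatorLaw (#3″ —
(α) frames that reg, (β) makes it coercive; (ii) along it is (a′) through the proved
SignDefectForcesCrossing); Sketch.lean rc 0: the rev-29 bridge IMPLIES this one (bridgeR_of_bridge —
a weakening, like C′), conclusion VERBATIM; earlier: THRESHOLD form on rattack-17705
(RobustYangMillsRG's ∃β₀-before-∀ℓ₀ format is consumable only for quarks heavy in block units; the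
light range is the named node #6); 13880's 13 landed modules + 9 Negatives carry over) —
RobustYangMillsRG → EarlyCrosserLaw → FrameAndSeparatorLaw → for N_f ∈ {2,3} ONE admissible reg
(HMS, HAS; weak branch m_crit(k) ≥ −1 eventually, from (α)), a THRESHOLD M₀ ≥ 0, the TWO-SIDED
PARITY PIN ABOVE THRESHOLD ((b),(b″) for M > M₀ — the line's own) and the QCDOf body at every m >
M₀: (1) BOSONIC SEA FLOW of the separator activities N_f log|det S_Σ(c)| (coercive by (β)) by a
Bałaban block RG from a_k to ℓ₀ = c/M₀ INTO THE PREMISE FORMAT of RobustYangMillsRG (signed RP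
weight in one-block-step Bałaban representation in the COERCIVE format of #4 rev 3 — ITS coercive
principal functional A is a smooth coercive quasi-local interpolation of the background action of a
FAT covariant averaging (coercivity of fat averaging: a rough block plaquette costs O(1) fine action
in the two-block neighbourhood; rough-field defects go into F); RP on the branch = fact
WilsonQCDSiteReflectionPositivityAP); (2) HEAVY BLOCK INTEGRATION at ℓ₀; (3) SIGN TRANSFER
phase-quenched → signed by Kotecký–Preiss in the window-dilute cells ((ii) from (a′)); (4) branch
and pin are projections of the hypotheses; (5) FINE FROM BLOCK — since #4 rev 3 is block-level, fine
slab clustering (hence the lattice gap in gauge AND quark channels) comes from #4's block clustering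
+ conditional decoupling in the bridge's own fibres (Bałaban fluctuation fields, heavy quark lines
at block mass ≥ c); (6) the subsequential OS limit of ALL QCD species with E0, E0′, E2, E3, E4 and
translations (UV stability of the sea family — the same Bałaban technology as (1)) and
non-triviality / non-Gaussianity of glue and flavoured pseudoscalars (asymptotic freedom at short
distance); (7) E1 — `OSData` is assembled from that rotation-free package plus the shared QCD E1
module RotationRestoration (stmt-QuantumFields-8840: HasAsymptoticScaling, m_q > −1 eventually, a
lattice gap and the limit of qcdLatticeSchwinger ⇒ SO(4)-invariance on ⁰𝒮) applied to reg.scheme m z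
shift — an IMPORT of this item (its proof consumes the landed theorem of 8840 or a line stub with
8840's text; the BY-NAME form `RobustYangMillsRG → RotationRestoration → EarlyCrosserLaw →
FrameAndSeparatorLaw → …` with the matching closes is typed and checked in the repair seat's
Sketch.lean (SeaFactorisationBridge3 / closes3) and waits for a free item+crux slot). The bridge
chooses M₀ ≥ every threshold ((β)'s M₁, the format's); the ∃reg conclusion keeps subsequence /
re-basing freedom; the shape 14958 can feed (= the sibling's ThresholdQCD plus the pin). [deps:
RobustYangMillsRG, EarlyCrosserLaw, FrameAndSeparatorLaw; import: RotationRestoration stmt-8840]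
[difficulty: open-problem; contains neither the sea laws nor light quarks; since #4 went block-level
it DOES contain the UV/OS half for the sea family (fibre physics), formerly supplied by #4 rev 2]
(why it might fail: landing determinant activities in Bałaban's one-block format at ℓ₀ = c/M₀ is
undone; KP transfer needs gluonic mixing beyond phase-quenched dilution; (β) gives (i) only on large
boxes in a sub-window ℓ′ — the flow must live with ℓ′, S₀; no hypothesis speaks of the fermionic
sector (pseudoRe, flavoured HasLatticeMassGap); E1 only through the imported module 8840; (h0) needs
a fat coercive averaging certified into the coercive format; fine-from-block transfer, OS limit and
non-triviality are now inside.) [Balaban1988Convergent, Balaban1989LargeFieldII,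
BalabanOcarrollSchor1989, Dimock2022QED3, KoteckyPreiss1986, BricmontKupiainenLefevere1998,
AppelquistCarazzone1975, JaffeWitten2000]
#6 LightQuarkCompletion (crux; RESTATED 2026-08-17 from JumpLineIsChiral 17706 = the refuter's NAMED
LIGHT-RANGE half (B2) ∧ the chirality crux (J), to be SPLIT with pure-logic glue B2 → J → #6
(Sketch.lean) so that B1 | B2 | J are separately staffed within the top-level caps) — for N_f ∈
{2,3}, EVERY reg as #5 outputs (HMS, HAS, weak branch, threshold M₀, two-sided pin above M₀, body
above M₀) admits a regularisation reg′ (intended: reg re-pinned at its own parity-jump line, along a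
subsequence) on the physical branch (m′_crit → 0), pinned at ZERO threshold from both sides,
carrying the QCDOf body at EVERY positive tuple, and CHIRAL AT ZERO — the witness of the re-typed
QCDOf N_f. Children: #6a ZeroThresholdDescent (crux) — same hypotheses, conclusion without
chirality: the jump band sharpens to o(a_k/Z_m) (EarlyCrosserLaw (b),(b″) at M₀ = 0 along reg′: (b″)
= (L5) at every m > 0, (b) = index modes crossed below the line; the two-sided jump singles out the
physical critical line among the doubler branches, so m′_crit → 0 like −c g₀²) and the body
continues from m > M₀ down to every m > 0 — IR completion below the threshold scale 1/M₀ (the UV is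
the hypothesis'; the new range is chiral dynamics; a sea line restated by tenure at M₀ = 0 on the
branch would become an explicit hypothesis); #6b JumpLineIsChiral (crux, VERBATIM the rev-26
statement) — every admissible branch reg pinned at zero threshold is chiral at zero: parity-jump
line = zero-mode edge of H_W = γ₅D_W on physical volumes = Aoki-phase boundary (c₂ > 0, massless
lattice pions) or first-order line (c₂ < 0, minimum pion mass O(a)) of Wilson χPT, and the chiral
limit of N_f ≥ 2 QCD is gapless (Goldstone, GMOR). Lattice-only; nearest in-tree
EulerDescent.ChiralCornerSoftness and the sibling's ChiralCompletion (implies #6 with the pin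
forgotten). [deps: SeaFactorisationBridge] [difficulty: open-problem (light-quark/chiral Wilson
lattice QCD), below Clay] (why it might fail: false if the jump band keeps RGI width ↛ 0
(first-order metastability), if light masses meet an Aoki/first-order artefact eventually in k, if
the full-spectrum lattice gap cannot be continued below M₀, or (6b) if a pinned reg keeps a uniform
gap at all small m; lattice Goldstone/GMOR unproved.) [SharpeSingleton1998, Aoki1984WilsonPhase,
GoltermanShamirSvetitsky2005, GoltermanShamir2003, EdwardsHellerNarayanan1998, GasserLeutwyler1984,
MontvayMunster1994, VafaWitten1984]
#3′ CoerciveOfDilute (SUPPORT again since the frame repair of 2026-08-17 — it is no longer a binder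
of `closes`, its research content being #3″ (β) ∀-aligned; stmt-QuantumFields-14759, rank 9;
promoted to crux for one day as a conjecture-grade binder of the rev-29 chain) — NegativeCellsDilute
→ CoerciveSea = the separator Wegner law (i) along the dilution-certified regularisation, BY NAME (∃
→ ∃); #3 = #2′ ∧ #3′ exactly; closes by coerciveOfDilute_of_coerciveSea (landed) once #3 does; its
five crux ideas of 2026-08-17 (Cruxes/CoerciveOfDilute/Ideas) are read-first material for #3″ (β).
[difficulty: open-problem as #3 (i)] [Wegner1981DensityOfStates, FrohlichSpencer1983,
GoltermanShamir2003, MohlerSchaefer2020] #9 supports, PROVED: SchurCellStep, DirichletDetReal,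
DiluteOfCoercive, SignDefectForcesCrossing, KineticEdge, ChiralityPairing (the seventh, the
pure-logic DiluteOfEarlyCrossers `EarlyCrosserLaw → SignDefectForcesCrossing → NegativeCellsDilute`,
proved @ f8f59edf6c93, was DROPPED 2026-08-17 to free the item slot for #3″ — the only decl whose
module has no importers; its proof stays re-landable verbatim as a standalone lemma); Assembly =
`closes` verbatim (provable-now, `unfold Assembly; exact closes`). Deciding theorem: `closes :
RobustYangMillsRG → EarlyCrosserLaw → FrameAndSeparatorLaw → SeaFactorisationBridge →
LightQuarkCompletion → QCD` (every binder a crux, every binder used). Items: top level 7 cruxes (2,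
2′, 3, 3″, 4 shared, 5, 6) + 7 supports (six proved + 3′) + Assembly = 15; foreseen second layer:
under #3 (PinnedDilutionOnBranch + glue by the landed composition), under #3″ (stubs (α) | (β)),
under #5 (BosonicSeaFlow → HeavyBlockIntegration → SignedFromQuenched), under #6
(ZeroThresholdDescent → JumpLineIsChiral).

TWO-LAYER PLAN (glued splits). EarlyCrosserLaw (a') ⇐ SmallCarrierRarity (a sub-box of side ≤
C·ρ_*(k) of a window cell singular above the lightest valence mass has phase-quenched probability ≤
(side/ρ_*)⁴(ρ_* a_kΛ)^{4+η}: a Bałaban small-field statement at the UV-CONVERGENT end) →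
NoLargeCarriers ((L3)–(L4); needs a `kernelSupport` definition) → PairBandBelowValence
(collision-born real pairs stay o(a_k/Z_m)-close to the line: WχPT width ∝ a³) → (a'); (b),(b″) ⇐
IndexModesCrossAtTheLine + parity of Q_eff on R-tori (χ_t R⁴ ≳ 0.35). CoerciveSea ⇐
NegativeCellsDilute + CoerciveOfDilute (filed, by name) and — the split this seat could not file
(final-cycle-only rule), ready for tenure — `--split CoerciveSea --into PinnedDilutionOnBranch
(support; the registered external stub stub_pinnedDilutionOnPhysicalBranch verbatim = 13900 +
Tendsto branch; statement in the planner folder, stmt_PinnedDilutionOnBranch.txt) +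
[FrameAndSeparatorLaw.2]` with glue the landed composition (Sketch.lean coerciveSea_glue_provable,
one line). FrameAndSeparatorLaw ⇐ registered STUBS of its line (depth 1, never items):
TwoSidedPinOnBranch (α: parity bookkeeping of real-mode clusters on physical tori + χ_t>0-type lower
bound + m_c(β) → 0) | SeparatorLawLarge (β: = stub_separatorLawLarge; SmallFieldSeparatorGap →
LumpLifting, or the propagator law p111601). Bridge (threshold) ⇐ BosonicSeaFlow (into
RobustYangMillsRG's premise format at ℓ₀ = c/M₀) → HeavyBlockIntegration → SignedFromQuenched.
LightQuarkCompletion ⇐ ZeroThresholdDescent → JumpLineIsChiral (glue pure logic, Sketch.lean; filed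
by this repair or by tenure). Below the children only `--supports` lemmas (never a third layer):
ZeroThresholdDescent ← JumpBandSharp (EarlyCrosserLaw (b),(b″) at M₀ = 0 along the re-pinned reg) +
LightBodyDescent (body continued below 1/M₀: chiral-regime IR completion); JumpLineIsChiral ←
JumpIsZeroModeEdge (the parity-jump line on physical tori lies within o(a_k/Z_m) of the zero-mode
edge of H_W: the pin read through Banks–Casher for H_W) + EdgeIsGapless (at the edge the flavoured
pseudoscalar lattice mass → 0 in physical units uniformly in k: Aoki/Sharpe–Singleton + GMOR, or a
Goldstone theorem for the flavour-parity-broken phase).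

KILL CRITERIA. (i) ¬EarlyCrosserLaw with ¬NegativeCellsDilute — window crossing/defect fractions at
fixed physical ℓ NOT vanishing with k (F1′ chirality test with a pair band shrinking no faster than
a; F3′ scaling slower than a^{(b−4)/2}); or index modes crossing over a band ≳ a_k M/Z_m (pin false
on R-tori) — refutes the hinge too (DiluteOfCoercive): close `refuted:NegativeCellsDilute` unless
misstated with a repaired window/pin. ¬EarlyCrosserLaw ALONE ((a′) false, (a) true) retires #2 as
the line and keeps #2′ and the route: `closes` is re-pointed through a two-sided-pinned restatement
of NegativeCellsDilute (census). (ii) ¬FrameAndSeparatorLaw through (β) (a physical-branch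
pinned-dilute reg with non-coercive large window separators), equivalently ¬CoerciveSea via (i) /
¬CoerciveOfDilute — pivot: restate (β) conditioned on Bałaban small fields or shrink to the
propagator form, keep (α); refuted again ⇒ close `refuted:FrameAndSeparatorLaw`. (ii′)
¬FrameAndSeparatorLaw through (α) (an admissible reg with a sharp two-sided parity jump eventually ≳
1 below the physical line, or on a doubler line) ⇒ misstated-class for the ROUTE, not the physics:
the branch must then be carried by the line itself — restate #2 in place with `Filter.Tendsto
reg.mcrit atTop (nhds 0)` (tenure, module cost accepted) and (α) dropped from #3″. (iv)
RobustYangMillsRG refuted-substantive ⇒ this bridge and HeavyThresholdYMBridge both go dormant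
(shared fate); refuted-misstated ⇒ re-attach the repaired item (precedents 14660 → 14958 → 17812;
the last, the wild measurable blocking, repaired by an abstract analytic COERCIVE principal
functional + block-level conclusion, shared with the sibling). (iv‴) ¬RotationRestoration (8840) for
N_f ∈ {2,3} schemes ⇒ #5 loses E1: restate its conclusion rotation-free and carry E1 as a new named
node; refuted only in the unintended N_f ≥ 17 regime ⇒ follow the shared repair (guard N_f ≤ 16).
(iv′) ¬JumpLineIsChiral by a pinned admissible branch reg with a uniform gap at all small m ⇒
misstated-class repair: `--resplit LightQuarkCompletion` pinning m_crit to the gapless edge directly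
(EulerDescent.ChiralCornerSoftness form), the jump-vs-edge identification moved into
ZeroThresholdDescent; refuted substantively (no pinned Wilson r = 1 trajectory is chiral at zero) ⇒
the re-typed conjunct is unreachable along Wilson fermions for every route — finding for the human;
close refuted:LightQuarkCompletion. (iv″) ¬ZeroThresholdDescent (jump band not sharpening / body not
continuable below M₀) ⇒ `--resplit` #6 through the sibling's ChiralCompletion form (re-pin at the
LUB of the gapless set, no parity pin); refuted again ⇒ the route certifies threshold QCD only — not
a thesis: close. (v) HeavyThresholdYMBridge's ConstructiveDecouplingRG proved by block averaging
moots #5 (supersede), not cruxes 2–3, 6.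

NOT DECOMPOSED YET. TENURE ACTIONS on the SEA side: DONE 2026-08-17 as NEW decls (in-place restates
break ~60 landed modules): 14759′ = FrameAndSeparatorLaw (β) (stub_separatorLawLarge verbatim), the
frame = FrameAndSeparatorLaw (α), 13901 parked as the by-name conjunction node, 14759 back to
support. STILL OPEN: 13900′ = PinnedDilutionOnBranch as split child of 13901 with glue by the landed
composition (statement + Sketch ready in the repair seat's folder; `--split` is final-cycle-only);
the branch clause on 13995/13900 in place (now moot for `closes`, still the honest typing — only at
a module-rebuild moment); re-land the dropped DiluteOfEarlyCrossers as a standalone Theorems lemma;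
re-prove Assembly (`exact closes`). The bridge's own split (BosonicSeaFlow → HeavyBlockIntegration →
SignedFromQuenched) waits for a bridge lead's skeleton; #6's split (ZeroThresholdDescent →
JumpLineIsChiral) is typed (previous repair seat's Sketch). Also: the one-loop response constant c₁
of (L4); the definition `kernelSupport`; the small-field statement behind SmallCarrierRarity
(Bałaban small/large-field decomposition up to the window scale with a lattice 'index costs 8π²/g²(1
− O(1/ρ²))' lemma, Luscher1982Topology); the pair-band estimate beyond WχPT; the Goldstone/edge
lemmas behind JumpLineIsChiral and the band-sharpening/continuation lemmas behind
ZeroThresholdDescent; ActivityTelescoping; the KP polymer set-up for nested cells; OS details shared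
with HeavyThresholdYMBridge; every constant. All `--supports` lemmas or glued splits, never a third
layer. TENURE (from the 2026-08-17 repair of #4): (a) attach RotationRestoration (stmt-8840) BY NAME
and restate #5 as `RobustYangMillsRG → RotationRestoration → EarlyCrosserLaw → FrameAndSeparatorLaw
→ …` with `closes` binding it (texts checked in the repair seat's Sketch.lean) as soon as an
item+crux slot frees — the natural source is retiring the two legacy UNUSED cruxes
NegativeCellsDilute 13900 / CoerciveSea 13901 (outside the deciding cone, glue.unused-crux advisory)
once their ~30 referencing modules allow, or a cap override; (b) #4 is now block-level, so #5's
foreseen split should read BosonicSeaFlow (coercive format at ℓ₀) → FineFromBlock (fibre decoupling: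
fine slab clustering + lattice gap) → ContinuumPackage (OS⁻ limit, non-triviality; E1 by 8840) →
SignedFromQuenched — at most 3 children per split, so group as (BosonicSeaFlow | FineFromBlock ∧
SignedFromQuenched | ContinuumPackage) when a bridge lead files the skeleton; (c) a Negative lemma
'the β = 0 Haar image violates βe·cA·ε ≫ B₀' would certify in Lean that the landed witness misses
rev 3.

CHEAPEST FALSIFIER. (F0', literature-only, kills #6b and #6a's zero-threshold pin together) JUMP =
κ_c: in published N_f = 2 unimproved-Wilson scans (Aoki-phase searches hep-lat/0309057; twisted-mass
first-order studies hep-lat/0406039) the κ at which the sign/low-mode observables of H_W jump must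
coincide, within the quoted resolution, with κ_c from m_π → 0 (Aoki scenario) or with the
first-order jump (tm scenario); a resolved offset that does not shrink between two β refutes
JumpLineIsChiral as typed (and with it LightQuarkCompletion's pinned form). (F1') CHIRALITY OF EARLY
CROSSERS: on MohlerSchaefer2020's CLS configurations with a negative real strange mode, histogram
|χ| = |(ψ,γ₅ψ)| at the crossing: (L3)–(L5) predict |χ| ≳ 0.7 rising with β; a peak at 0 with partner
crossings means pair-collision carriers and kills the carrier identification. (F2') SIZE: carriers
above the line have size ≤ ρ_* = 3.6–6.9 a on CLS strange ensembles, shrinking in fm like a^{1/2}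
(hosting cells of side ≥ 7.5 by KineticEdge); a non-shrinking physical-size carrier population
refutes (L4). (F3') SCALING: early-crosser frequency per fixed physical 4-volume must fall at least
like a^{(b−4)/2} = a^{2.5} (N_f = 3), a^{2.83} (N_f = 2); MS2020's a^{≈6.8} passes. (F4') one-loop
c₁ on the ρ = 2…6 lattice instanton in Dirichlet boxes. (F5', kit j007134 on 13900) perturbed
Dirichlet cells: real eigenvalues vs kinetic floor. (F6', #6a) partially-quenched Wilson data: the
sea-mass dependence of κ_c in RGI units, Z_m Δκ_c/a, must shrink between two β (else no
mass-independent zero-threshold pin). (F7′, #3″ (α), literature/in-tree) PARITY BOOKKEEPING: in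
published Wilson spectral-flow data (EdwardsHellerNarayanan1998, hep-lat/9802016;
MohlerSchaefer2020) the fraction of configurations with Re det D_W(μ) < 0 on a fixed physical volume
must be ≲ a few % above κ_c(β) and ≈ P(Q odd) ≈ 1/2 from just below κ_c down through the first
doubler region with NO second dip; a resolved dip below 1/8 between the physical line and m = −2 at
two β refutes (α); in-tree, the even doubler multiplicities 4, 6, 4 are a finite check on the free
Wilson operator (native_decide-sized). (F8′, #4 rev 3) REALISABILITY + STEEPNESS: (a) exhibit one
fat covariant averaging whose blocked a.f. Wilson law is in the COERCIVE format (a coercive analytic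
quasi-local A with A(V) − A(𝟙) ≥ cA·S_W(V)) — if no intended member is certifiable the class is
empty in practice and #4 unconsumable; (b) paper check that NO measurable cor-covariant 5b-local
blocking pushes the β = 0 Haar weight to a block law of density e^{−βe·A − W}·F with coercive A
(covariance keeps single-link marginals Haar; block curvature is not locally removable) — a
counterexample revives the junk class under rev 3.

NUMBERS. β = 2/g₀²; 1/b₀ = 16π²/(11 − 2N_f/3) = 17.55 (N_f = 3), 16.34 (N_f = 2); γ₀/(2β₀) = 4/9,
12/29. Kinetic edge: |m_c| = 0.82 (β_W = 6.0) ⇒ s ≤ 4 crossing-free; 0.345 (β_W = 3.4) ⇒ s ≤ 7. ρ_*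
= 3.6 a (0.086 fm) → 4.7 a (0.05 fm). MS2020 ⟨n_neg⟩ ∝ a^{≈6.8} ⇒ b' ≈ 9, c₁ ≈ 0.06. Aoki band ∝ a³
vs valence offset ∝ a/Z_m. Pin: χ_t R⁴ ≳ 0.35 ⇒ R ≳ 0.8 fm. Items: top level 7 cruxes (2, 2′, 3, 3″,
4, 5, 6) + 7 supports + Assembly = 15; foreseen children under #3, #3″ (stubs), #5, #6.

DEFINITION REQUESTS. None open (D1 LANDED as
Literature/MathematicalPhysics/QuantumLattice/WilsonCellSchur.lean; all cruxes are stated over it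
and QCDOS). Foreseen, not filed: `kernelSupport`, `singularDeflation`.

IMPORT CONE (rev 38): back to WilsonCellSchur + QuasiLocalGaugePerturbation (the
BalabanFormatDensity import of revs 33–37 served only the retired bundled filing 18010); `closes`
unchanged (RobustYangMillsRG → EarlyCrosserLaw → FrameAndSeparatorLaw → SeaFactorisationBridge →
LightQuarkCompletion → QCD) and certified natively.

Novelty: Searches (2026-08-15; opening seat, two novelty audits, promote g0 recorded in the history; this
promote-g2 seat ran): `lit galaxy search "real eigenvalues of the Wilson-Dirac operator" --star all`
(1 panama row, an eigensolver proceedings volume — noise; pdf/crabby 0); `lit galaxy search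
"Lifshitz tail" --star all` (10 panama book rows: den Hollander–Molchanov–Zeitouni Saint-Flour,
Chulaevsky–Suhov multi-scale analysis, Redner … — random-media texts, none on lattice gauge fields;
pdf/crabby queued-too-long); `lit galaxy search "random magnetic field" --star pdf` (10, noise);
`lit search --source arxiv "Lifshitz tails random magnetic Schrodinger"` → Ghribi–Hislop–Klopp
arXiv:0708.1774 (localization for random VECTOR potentials); `lit search --source crossref
"Lifschitz tail magnetic field Erdos"` → Erdős 1998 doi:10.1007/s004400050193, Erdős 2001
doi:10.1007/pl00008803 (Lifschitz tails in a magnetic field), Ueki 2002 doi:10.4099/math1924.28.261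
(random PAULI Hamiltonian), Sznitman 1990; `lit search` local/hybrid ×4 rc 75 (searchd off-box,
logged), OpenAlex 429; holdings audit of every cited key (`lit read --meta`): all ten sources of the
tier-deciding crux are HELD (MohlerSchaefer2020 = arXiv:2003.13359, EdwardsHellerNarayanan1998 =
hep-lat/9802016, EdwardsHellerNarayananInstanton1998 = hep-lat/9801015,
BerrutoNarayananNeuberger2000 = hep-lat/0006030, GoltermanShamir2003 = hep-lat/0306002,
HernandezJansenLuscher1999 = hep-lat/9808010, Neuberger2000 = hep-lat/9911004, Adams200  [refs: 10.1007/s004400050193, 10.1007/pl00008803, 10.4099/math1924.28.261, 10.1016/s0370-2693(99, 10.1016/j.cpc.2011.10.007, 0708.1774, 2003.13359, 1609.02419, doi:10.1007/s004400050193, doi:10.1007/pl00008803, doi:10.4099/math1924.28.261, doi:10.1016/s0370-2693, doi:10.1016/j.cpc.2011.10.007, MohlerSchaefer2020, EdwardsHellerNarayanan1998, EdwardsHellerNarayananInstanton1998, BerrutoNarayananNeuberger20]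

Barriers (technique_class: schur-multiscale, numerical-range, nonnormal-perturbation): - technique_class: multiscale-factorisation, domain-decomposition, block-rg, numerical-range,
non-normal-perturbation, small-instanton-counting
- Literature.Barriers.QuantumFields.HoppingExpansionUniformGap: evaded — no hopping series is summed
on the fine lattice; coercivity of a cell of side s comes from the Dirichlet kinetic floor Σ(1 −
cos(π/s_i)) ≍ 2π²/s² (KineticEdge, deterministic) below the mesoscopic scale and is asked only in
probability above it (CoerciveSea (i)); the hopping/Schur expansion appears only at the block scale
ℓ₀ where the quark mass is O(1) in block units (inside the bridge).
- Literature.Barriers.QuantumFields.HoppingExpansionLocality: evaded the same way — locality of each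
factor is EXACT cell support of a Schur complement.
- Literature.Barriers.QuantumFields.WilsonDeterminantSign: not evaded but LOCALISED and
KINEMATICALLY CONSTRAINED — (−1)^(n₋) = ∏ cell signs exactly; a cell sign can flip only through a
crossing at or above the valence mass (SignDefectForcesCrossing), impossible in cells of side <
π(2/|m_c|)^{1/2} and carried only by mesoscopic smooth envelopes above (KineticEdge); a cell sign
flips only through a CROSSING ABOVE THE VALENCE MASS, whose carriers are chiral (chirality = 1/κ,
law of motion) smooth lumps capped in size by the valence offset (ρ_* ∝ a^{−1/2}); the bet
(EarlyCrosserLaw ⇒ NegativeCellsDilute) is window-dilution of those early crossers, counted by the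
UV-convergent instanton measure, which the bridge turns into a Kotecký–

Novelty grade: new-combination — route-review grade (refuter rreview-0815T16-5-g2-0). Mechanism = exact nested-dissection (all-scales) Schur factorisation of the Wilson determinant into local real scale-indexed separator factors (iterating the one-level Cè–Giusti–Schaefer factorisation along George's elimination hierarchy) ⊕ Fröhli (refuter refuter-rreview-0815T16-5-g2-0, 2026-08-15T18:26:56Z; prior: arXiv:1609.02419 = CeGiustiSchaefer2017 §2 (+ CeGiustiSchaefer2016, GiustiSaccardi2022): ONE-level Schur/domain-decomposition factorisation of det D_W for multilevel Monte Carlo, factors real, numerical suppression ∝ exp(−M_πΔ), George1973 (nested dissection ordering), FrohlichSpencer1983, BachFrohlichSigal1998 (multiscale resonant-box bookkeeping / iterated Schur–Feshbach maps for RESOLVENTS; Weg)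

History (route lifecycle, newest last):
- 2026-08-17T00:56:50Z · rev 31: restated Assembly (stmt-QuantumFields-18067 proved) — route-repair (rattack-18065) step 2/3 — mechanical slot-freeing edit (precedent rev 25): drop the proved pure-logic support DiluteOfEarlyCrossers (content inlin (planner-rrefute-QuantumFields-NestedDissection-4647e636-0)
- 2026-08-17T00:56:50Z · rev 31: dropped DiluteOfEarlyCrossers — route-repair (rattack-18065) step 2/3 — mechanical slot-freeing edit (precedent rev 25): drop the proved pure-logic support DiluteOfEarlyCrossers (content inlin (planner-rrefute-QuantumFields-NestedDissection-4647e636-0)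
- 2026-08-17T01:01:46Z · rev 32: restated SeaFactorisationBridge (stmt-QuantumFields-18065), Assembly (stmt-QuantumFields-16993) — route-repair (rattack-18065, refuted-misstated 'missing frame on hypothesis 2') step 3/3: ADD the ∀reg crux FrameAndSeparatorLaw (rank 3: (α) two-sided pin ⇒ m_ (planner-rrefute-QuantumFields-NestedDissection-4647e636-0)
- 2026-08-17T01:45:03Z · BROKEN — RobustYangMillsRG (stmt-QuantumFields-14958, crux) refuted by Summit.QuantumFields.QCD.Theorems.not_RobustYangMillsRG @ 42cbf9ef150e (prover-line-stmt-QuantumFields-14958-c1-0)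
- 2026-08-17T02:18:22Z · rev 34: restated RobustYangMillsRG (stmt-QuantumFields-14958 refuted) — repair step 2/2: RobustYangMillsRG (stmt-14958) refuted-misstated by Summit.QuantumFields.QCD.Theorems.not_RobustYangMillsRG (wild measurable blocking: Haar→Haa (planner-rfix-QuantumFields-NestedDissectionS-8dee2a56-0)
- 2026-08-17T02:18:22Z · REPAIRED (restate RobustYangMillsRG) — back to open: repair step 2/2: RobustYangMillsRG (stmt-14958) refuted-misstated by Summit.QuantumFields.QCD.Theorems.not_RobustYangMillsRG (wild measurable blocking: Haar→Haa (planner-rfix-QuantumFields-NestedDissectionS-8dee2a56-0)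
- 2026-08-17T02:27:45Z · rev 37: restated RobustYangMillsRG (stmt-QuantumFields-18010) — SHARE the YM-side named condition: restate RobustYangMillsRG 1:1 to the sibling HeavyThresholdYMBridge's rev-3 text (stmt-QuantumFields-17812, filed 02:12Z, six (planner-rfix-QuantumFields-NestedDissectionS-8dee2a56-0)
- 2026-08-24T21:48:41Z · DORMANT — reconciler: no traction for 7.1 d (last activity item-evidence-added at 2026-08-17T18:51:48Z); parked, not closed — `ledger route dormant route-QuantumFields-Ne (operator:999:1213346)

sub-problem: QCD · status: dormant · opened planner-plancard-QuantumFields-QCD-nested-dis-65840289-0 2026-08-15T16:58:52Z · rev 40 · ledger route-QuantumFields-NestedDissectionSea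
GENERATED by the gate from the ledger (D-0016/17). Provers cite these decls: `theorem foo : Summit.QuantumFields.QCD.Theses.NestedDissectionSea.<Decl> := …` in Summits/QuantumFields/QCD/Theorems/<Name>.lean.
-/

namespace Summit.QuantumFields.QCD.Theses.NestedDissectionSea

open scoped BigOperators Topology Manifold Classical MeasureTheory ProbabilityTheory Matrix InnerProductSpace ComplexConjugate ContinuousMap
open Filter Set Function TopologicalSpace MeasureTheory

attribute [summit_statement] _root_.QCD

-- earlier NegativeCellsDilute (stmt-QuantumFields-11271, replaced 2026-08-15T22:38:06Z -> stmt-QuantumFields-13900): retired by None — open Literature.MathematicalPhysics.QuantumLattice Literature.MathematicalPhysics.QuantumFieldTheory Literature.Probability.LatticeModels in ∀ Nf : ℕ, (Nf = 2 ∨ Nf = 3) → ∃ reg : QCDRegularisation Nf, reg.HasMassScaling ∧ (reg.scheme 0 0 0).HasAsymptoticScaling ∧ ∃ M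
/-- item stmt-QuantumFields-13900 · crux · rank 2 · open · by planner
why it might fail: As EarlyCrosserLaw (which implies it): pair-collision carriers (chirality → 0) with an Aoki-type band above m_crit shrinking no faster than the valence offset a_k m/Z_m would keep O(1) defect probability in window cells (Σδ_j ↛ 0); the pin fails if index modes cross over a band ≫ a_k M/Z_m.
sources: MohlerSchaefer2020, EdwardsHellerNarayanan1998, EdwardsHellerNarayananInstanton1998, BerrutoNarayananNeuberger2000, GoltermanShamir2003, GoltermanShamirSvetitsky2005
[crux] WINDOWED LOCAL DILUTION + PARITY PIN (restated 2026-08-15, promote-to-A; repairs both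
misstating directions recorded by refuters rattack-11271 (EVIDENCE.md/Cprime.lean R2), g43-27,
rreview-g2 (Probe.lean) and REVIEW O1: the ∀-volume top-factor/all-scales clause (junk-FALSE at
fixed k, S → ∞) is gone — dilution is asked per box (translation invariance: corner 0 is every
position) and only INSIDE THE PHYSICAL WINDOW s_i a_k ≤ ℓ, i.e. sign carriers must be dilute along
SHEETS of window cells, not absent; the pin now lives on tori of FIXED physical size ≥ R (kills the
scheme-freedom junk m_crit ≡ 0 + volume inflation, which has P(neg det) → 0 in fixed physical
volume). For N_f ∈ {2,3} there is ONE mass-independent regularisation reg (HasMassScaling,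
HasAsymptoticScaling), M₀ ≥ 0, a leaf size b₀ ≥ 2 and a physical window ℓ > 0 such that for every
mass tuple m > M₀ there is a physical size R > 0 with: (a) DILUTION — for every ε > 0, eventually in
k, on EVERY odd torus of physical side ≥ R (all volumes, uniformly), under the phase-quenched weight
e^(−β_k S_W)∏_f|det D_W(m_f(k))|, m_f(k) = m_crit(k) + a_k m_f/Z_m(k), a corner-0 open box with
sides in [b₀2^j, b₀2^(j+2)), s_i ≤ N, s_i -/
@[route_item "route-QuantumFields-NestedDissectionSea"]
def NegativeCellsDilute : Prop :=
  open Literature.MathematicalPhysics.QuantumLattice Literature.MathematicalPhysics.QuantumFieldTheory Literature.Probability.LatticeModels in ∀ Nf : ℕ, (Nf = 2 ∨ Nf = 3) → ∃ reg : QCDRegularisation Nf, reg.HasMassScaling ∧ (reg.scheme 0 0 0).HasAsymptoticScaling ∧ ∃ M₀ : ℝ, 0 ≤ M₀ ∧ ∃ b₀ : ℕ, 2 ≤ b₀ ∧ ∃ ℓ : ℝ, 0 < ℓ ∧ ∀ m : Fin Nf → ℝ, (∀ f, M₀ < m f) → ∃ R : ℝ, 0 < R ∧ (∀ ε : ℝ,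 0 < ε → ∀ᶠ k : ℕ in Filter.atTop, ∀ S : ℕ, R ≤ reg.a k * (2 * S + 1) → let N : ℕ := 2 * S + 1; let mq : Fin Nf → ℝ := fun f => reg.mcrit k + reg.a k * m f / reg.Zm k; let wt : GaugeConfig 4 N (Matrix.specialUnitaryGroup (Fin 3) ℂ) → ℝ := fun U => ∏ f, ‖fermionDet (wilsonDirac (fundamentalRep (Fin 3)) U (mq f) 1)‖; let P : (GaugeConfig 4 N (Matrix.specialUnitaryGroup (Fin 3) ℂ) → Prop) → ℝ := fun E => (∫ U, (if E U then (1 : ℝ) else 0) * wt U ∂(wilsonMeasure (d := 4) (L := N) (fundamentalRep (Fin 3)) (reg.β k))) / (∫ U, wt U ∂(wilsonMeasure (d := 4) (L := N) (fundamentalRep (Fin 3)) (reg.β k))); let J : ℕ := Nat.log 2 (⌊ℓ / reg.a k⌋₊ / b₀) + 1; ∃ δ : ℕ → ℝ, ∑ j ∈ Finset.range J, δ j ≤ ε ∧ ∀ j < J, ∀ s : Fin 4 → ℕ, (∀ i, b₀ * 2 ^ j ≤ s i ∧ s i < b₀ * 2 ^ (j + 2) ∧ s i ≤ N ∧ (s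 i : ℝ) * reg.a k ≤ ℓ) → P (fun U => ∃ f, IsSignDefect U (mq f) j s) ≤ δ j) ∧ (∀ M : ℝ, M₀ < M → ∀ᶠ k : ℕ in Filter.atTop, ∀ S : ℕ, R ≤ reg.a k * (2 * S + 1) → let N : ℕ := 2 * S + 1; let mq : Fin Nf → ℝ := fun f => reg.mcrit k + reg.a k * m f / reg.Zm k; let wt : GaugeConfig 4 N (Matrix.specialUnitaryGroup (Fin 3) ℂ) → ℝ := fun U => ∏ f, ‖fermionDet (wilsonDirac (fundamentalRep (Fin 3)) U (mq f) 1)‖; (1 / 4 : ℝ) ≤ (∫ U, (if (fermionDet (wilsonDirac (fundamentalRep (Fin 3)) U (reg.mcrit k - reg.a k * M / reg.Zm k) 1)).re < 0 then (1 : ℝ) else 0) * wt U ∂(wilsonMeasure (d := 4) (L := N) (fundamentalRep (Fin 3)) (reg.β k))) / (∫ U, wt U ∂(wilsonMeasure (d := 4) (L := N) (fundamentalRep (Fin 3)) (reg.β k))))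

-- earlier EarlyCrosserLaw (stmt-QuantumFields-13978, replaced 2026-08-15T23:48:27Z -> stmt-QuantumFields-13995): retired by None — open Literature.MathematicalPhysics.QuantumLattice Literature.MathematicalPhysics.QuantumFieldTheory Literature.Probability.LatticeModels in ∀ Nf : ℕ, (Nf = 2 ∨ Nf = 3) → ∃ reg : QCDRegularisation Nf, reg.HasMassScaling ∧ (reg.scheme 0 0 0).HasAsymptoticScaling ∧ ∃ M₀ : 
/-- item stmt-QuantumFields-13995 · crux · rank 2 · open · by planner
why it might fail: Real modes are also born in near-real PAIR COLLISIONS (chirality → 0): if that band above m_crit shrinks no faster than the valence offset a_k m/Z_m (Aoki-type width ∝ a, not a³), window cells keep O(1) crossing probability, Σδ_j ↛ 0; the pin fails if index modes cross over a band ≫ a_k M/Z_m.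
sources: MohlerSchaefer2020, EdwardsHellerNarayananInstanton1998, EdwardsHellerNarayanan1998, GoltermanShamir2003, GoltermanShamirSvetitsky2005, SharpeSingleton1998
[crux] EARLY CROSSERS ARE WINDOW-DILUTE — the sharp, parity-free form of the tier-deciding crux
NegativeCellsDilute (stmt-QuantumFields-13900), filed 2026-08-15 by the promote-to-A g2 seat as THE
line on it (support DiluteOfEarlyCrossers: EarlyCrosserLaw → SignDefectForcesCrossing →
NegativeCellsDilute, pure logic, term-checked rc 0 — SketchR.lean). RESTATED 23:5xZ on refuter
g47-0's statement-design flag (mcrit is free data, so (a′) could be emptied by translating the line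
upward; only the pin ties it): the pin is now TWO-SIDED and intrinsic — (b) as in 13900 verbatim (a
distance M > M₀ BELOW the line the torus determinant is negative with probability ≥ 1/4 on every odd
torus of physical side ≥ R) AND (b″) a distance M > M₀ ABOVE the line it is negative with
probability ≤ 1/8 on odd tori of physical side in [R, 2R] (fixed physical volume, so not junk-false
at fixed k; this is Mohler–Schaefer's whole-lattice observable ⟨n_neg⟩ → 0 made a clause),
eventually in k: m_crit(k) is thereby DEFINED up to ±a_k M₀/Z_m as the line across which P(Re det <
0) on physical tori jumps from ≤ 1/8 to ≥ 1/4, from both sides, independently of the cell machinery.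
Same ∃reg/M₀/b₀/ℓ/∀m ∃R prefix as 1390 -/
@[route_item "route-QuantumFields-NestedDissectionSea", crux]
def EarlyCrosserLaw : Prop :=
  open Literature.MathematicalPhysics.QuantumLattice Literature.MathematicalPhysics.QuantumFieldTheory Literature.Probability.LatticeModels in ∀ Nf : ℕ, (Nf = 2 ∨ Nf = 3) → ∃ reg : QCDRegularisation Nf, reg.HasMassScaling ∧ (reg.scheme 0 0 0).HasAsymptoticScaling ∧ ∃ M₀ : ℝ, 0 ≤ M₀ ∧ ∃ b₀ : ℕ, 2 ≤ b₀ ∧ ∃ ℓ : ℝ, 0 < ℓ ∧ ∀ m : Fin Nf → ℝ, (∀ f, M₀ < m f) → ∃ R : ℝ, 0 < R ∧ (∀ ε : ℝ, 0 < ε → ∀ᶠ k : ℕ in Filter.atTop, ∀ S : ℕ, R ≤ reg.a k * (2 * S + 1) → let N : ℕ := 2 * S + 1; let mq : Fin Nf → ℝ := fun f => reg.mcrit k + reg.a k * m f / reg.Zm k; let wt : GaugeConfig 4 N (Matrix.specialUnitaryGroup (Fin 3) ℂ) → ℝ := fun U => ∏ f, ‖fermionDet (wilsonDirac (fundamentalRep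 (Fin 3)) U (mq f) 1)‖; let P : (GaugeConfig 4 N (Matrix.specialUnitaryGroup (Fin 3) ℂ) → Prop) → ℝ := fun E => (∫ U, (if E U then (1 : ℝ) else 0) * wt U ∂(wilsonMeasure (d := 4) (L := N) (fundamentalRep (Fin 3)) (reg.β k))) / (∫ U, wt U ∂(wilsonMeasure (d := 4) (L := N) (fundamentalRep (Fin 3)) (reg.β k))); let J : ℕ := Nat.log 2 (⌊ℓ / reg.a k⌋₊ / b₀) + 1; ∃ δ : ℕ → ℝ, (∀ j, 0 ≤ δ j) ∧ ∑ j ∈ Finset.range J, δ j ≤ ε ∧ ∀ j < J, ∀ s : Fin 4 → ℕ, (∀ i, b₀ * 2 ^ j ≤ s i ∧ s i < b₀ * 2 ^ (j + 2) ∧ s i ≤ N ∧ (s i : ℝ) * reg.a k ≤ ℓ) → ∀ E : GaugeConfig 4 N (Matrix.specialUnitaryGroup (Fin 3) ℂ) → Prop, (∀ U, E U → ∃ f : Fin Nf, ∃ μ' : ℝ, mq f ≤ μ' ∧ ((wilsonCell U μ' 0 s).det = 0 ∨ ∃ c : Fin 4 → Bool, (wilsonCell U μ' (halfCorner s c) (halfSides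 s c)).det = 0)) → P E ≤ δ j) ∧ (∀ M : ℝ, M₀ < M → ∀ᶠ k : ℕ in Filter.atTop, ∀ S : ℕ, R ≤ reg.a k * (2 * S + 1) → let N : ℕ := 2 * S + 1; let mq : Fin Nf → ℝ := fun f => reg.mcrit k + reg.a k * m f / reg.Zm k; let wt : GaugeConfig 4 N (Matrix.specialUnitaryGroup (Fin 3) ℂ) → ℝ := fun U => ∏ f, ‖fermionDet (wilsonDirac (fundamentalRep (Fin 3)) U (mq f) 1)‖; (1 / 4 : ℝ) ≤ (∫ U, (if (fermionDet (wilsonDirac (fundamentalRep (Fin 3)) U (reg.mcrit k - reg.a k * M / reg.Zm k) 1)).re < 0 then (1 : ℝ) else 0) * wt U ∂(wilsonMeasure (d := 4) (L := N) (fundamentalRep (Fin 3)) (reg.β k))) / (∫ U, wt U ∂(wilsonMeasure (d := 4) (L := N) (fundamentalRep (Fin 3)) (reg.β k)))) ∧ (∀ M : ℝ, M₀ < M → ∀ᶠ k : ℕ in Filter.atTop, ∀ S : ℕ, R ≤ reg.a k * (2 * S + 1) → reg.a k * (2 * S + 1) ≤ 2 * R → let N : ℕ := 2 * S + 1; let mq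 : Fin Nf → ℝ := fun f => reg.mcrit k + reg.a k * m f / reg.Zm k; let wt : GaugeConfig 4 N (Matrix.specialUnitaryGroup (Fin 3) ℂ) → ℝ := fun U => ∏ f, ‖fermionDet (wilsonDirac (fundamentalRep (Fin 3)) U (mq f) 1)‖; (∫ U, (if (fermionDet (wilsonDirac (fundamentalRep (Fin 3)) U (reg.mcrit k + reg.a k * M / reg.Zm k) 1)).re < 0 then (1 : ℝ) else 0) * wt U ∂(wilsonMeasure (d := 4) (L := N) (fundamentalRep (Fin 3)) (reg.β k))) / (∫ U, wt U ∂(wilsonMeasure (d := 4) (L := N) (fundamentalRep (Fin 3)) (reg.β k))) ≤ (1 / 8 : ℝ))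

-- earlier CoerciveSea (stmt-QuantumFields-11272, replaced 2026-08-15T22:38:58Z -> stmt-QuantumFields-13901): retired by None — open Literature.MathematicalPhysics.QuantumLattice Literature.MathematicalPhysics.QuantumFieldTheory Literature.Probability.LatticeModels in ∀ Nf : ℕ, (Nf = 2 ∨ Nf = 3) → ∃ reg : QCDRegularisation Nf, reg.HasMassScaling ∧ (reg.scheme 0 0 0).HasAsymptoticScaling ∧ ∃ M₀ : ℝ, 0
/-- item stmt-QuantumFields-13901 · crux · rank 3 · open · by planner
why it might fail: (i): typical lowest separator singular value ≍ c₁/s; the law needs its gauge-noise fluctuations at scales ≤ ℓ to be large deviations — false if the window top feels O(1) coupling g²(ℓ) or if non-normal cells pseudo-resonate without smooth carriers; (ii),(iii): as EarlyCrosserLaw/NegativeCellsDilute.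
sources: Sint1994, Luscher2003SchwarzDD, CeGiustiSchaefer2017, Wegner1981DensityOfStates, FrohlichSpencer1983, HernandezJansenLuscher1999
[crux] THE HINGE (restated 2026-08-15, promote-to-A, in parallel with NegativeCellsDilute; clauses
(ii)–(iii) are NegativeCellsDilute VERBATIM so that DiluteOfCoercive stays a projection,
term-checked). For N_f ∈ {2,3} there are ONE mass-independent regularisation reg (HasMassScaling,
HasAsymptoticScaling), M₀ ≥ 0, b₀ ≥ 2 and a physical window ℓ > 0 such that for every mass tuple m >
M₀ there is a physical size R > 0 with: (i) SEPARATOR WEGNER LAW IN THE WINDOW — for some C, α > 0,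
eventually in k, on every odd torus of physical side ≥ R, for every roughly cubic corner-0 open box
with sides b₀ ≤ s_i ≤ N, s_i a_k ≤ ℓ, s_i ≤ 2 s_j, every flavour and every t ∈ (0,1], the
phase-quenched probability of HasSingularSeparator U m_f(k) s (t/s₀) — a vector harmonic in the 16
children interiors, non-zero on the internal separator Σ, with separator residual below (t/s₀) × its
separator mass, i.e. σ_min of the Schur separator operator S_Σ in harmonic-extension form below t/s₀
— is ≤ C t^α (a Wegner law in units of the Dirichlet gap, uniform in k, volume and box); (ii) the
windowed local dilution of NegativeCellsDilute; (iii) its parity pin on tori of physical side ≥ R.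
Coercivity is asked of th -/
@[route_item "route-QuantumFields-NestedDissectionSea", crux]
def CoerciveSea : Prop :=
  open Literature.MathematicalPhysics.QuantumLattice Literature.MathematicalPhysics.QuantumFieldTheory Literature.Probability.LatticeModels in ∀ Nf : ℕ, (Nf = 2 ∨ Nf = 3) → ∃ reg : QCDRegularisation Nf, reg.HasMassScaling ∧ (reg.scheme 0 0 0).HasAsymptoticScaling ∧ ∃ M₀ : ℝ, 0 ≤ M₀ ∧ ∃ b₀ : ℕ, 2 ≤ b₀ ∧ ∃ ℓ : ℝ, 0 < ℓ ∧ ∀ m : Fin Nf → ℝ, (∀ f, M₀ < m f) → ∃ R : ℝ, 0 < R ∧ (∃ C : ℝ, 0 < C ∧ ∃ α : ℝ, 0 < α ∧ ∀ᶠ k : ℕ in Filter.atTop, ∀ S : ℕ, R ≤ reg.a k * (2 * S + 1) → let N : ℕ := 2 * S + 1; let mq : Fin Nf → ℝ := fun f => reg.mcrit k + reg.a k * m f / reg.Zm k; let wt : GaugeConfig 4 N (Matrix.specialUnitaryGroup (Fin 3) ℂ) → ℝ := fun U => ∏ f, ‖fermionDet (wilsonDirac (fundamentalRep (Fin 3))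 U (mq f) 1)‖; let P : (GaugeConfig 4 N (Matrix.specialUnitaryGroup (Fin 3) ℂ) → Prop) → ℝ := fun E => (∫ U, (if E U then (1 : ℝ) else 0) * wt U ∂(wilsonMeasure (d := 4) (L := N) (fundamentalRep (Fin 3)) (reg.β k))) / (∫ U, wt U ∂(wilsonMeasure (d := 4) (L := N) (fundamentalRep (Fin 3)) (reg.β k))); ∀ s : Fin 4 → ℕ, (∀ i, b₀ ≤ s i ∧ s i ≤ N ∧ (s i : ℝ) * reg.a k ≤ ℓ) → (∀ i j, s i ≤ 2 * s j) → ∀ f : Fin Nf, ∀ t : ℝ, 0 < t → t ≤ 1 → P (fun U => HasSingularSeparator U (mq f) s (t / s 0)) ≤ C * t ^ α) ∧ (∀ ε : ℝ, 0 < ε → ∀ᶠ k : ℕ in Filter.atTop, ∀ S : ℕ, R ≤ reg.a k * (2 * S + 1) → let N : ℕ := 2 * S + 1; let mq : Fin Nf → ℝ := fun f => reg.mcrit k + reg.a k * m f / reg.Zm k; let wt : GaugeConfig 4 N (Matrix.specialUnitaryGroup (Fin 3) ℂ) → ℝ := fun U => ∏ f, ‖fermionDet (wilsonDirac (fundamentalRep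 (Fin 3)) U (mq f) 1)‖; let P : (GaugeConfig 4 N (Matrix.specialUnitaryGroup (Fin 3) ℂ) → Prop) → ℝ := fun E => (∫ U, (if E U then (1 : ℝ) else 0) * wt U ∂(wilsonMeasure (d := 4) (L := N) (fundamentalRep (Fin 3)) (reg.β k))) / (∫ U, wt U ∂(wilsonMeasure (d := 4) (L := N) (fundamentalRep (Fin 3)) (reg.β k))); let J : ℕ := Nat.log 2 (⌊ℓ / reg.a k⌋₊ / b₀) + 1; ∃ δ : ℕ → ℝ, ∑ j ∈ Finset.range J, δ j ≤ ε ∧ ∀ j < J, ∀ s : Fin 4 → ℕ, (∀ i, b₀ * 2 ^ j ≤ s i ∧ s i < b₀ * 2 ^ (j + 2) ∧ s i ≤ N ∧ (s i : ℝ) * reg.a k ≤ ℓ) → P (fun U => ∃ f, IsSignDefect U (mq f) j s) ≤ δ j) ∧ (∀ M : ℝ, M₀ < M → ∀ᶠ k : ℕ in Filter.atTop, ∀ S : ℕ, R ≤ reg.a k * (2 * S + 1) → let N : ℕ := 2 * S + 1; let mq : Fin Nf → ℝ := fun f => reg.mcrit k + reg.a k * m f / reg.Zm k; let wt : GaugeConfig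 4 N (Matrix.specialUnitaryGroup (Fin 3) ℂ) → ℝ := fun U => ∏ f, ‖fermionDet (wilsonDirac (fundamentalRep (Fin 3)) U (mq f) 1)‖; (1 / 4 : ℝ) ≤ (∫ U, (if (fermionDet (wilsonDirac (fundamentalRep (Fin 3)) U (reg.mcrit k - reg.a k * M / reg.Zm k) 1)).re < 0 then (1 : ℝ) else 0) * wt U ∂(wilsonMeasure (d := 4) (L := N) (fundamentalRep (Fin 3)) (reg.β k))) / (∫ U, wt U ∂(wilsonMeasure (d := 4) (L := N) (fundamentalRep (Fin 3)) (reg.β k))))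

/-- item stmt-QuantumFields-17012 · crux · rank 3 · open · by planner
why it might fail: (α) false only if a sharp two-sided jump of sign det D_W on physical tori can sit eventually ≳1 below the physical line (abundant lattice-scale dislocations re-dipping P(Re det<0) below 1/8) or on a doubler line, or if m_c(β)↛0; (β)=13901(i): false if the window top feels O(1) g²(ℓ′).
sources: EdwardsHellerNarayanan1998, HasenfratzLalienaNiedermayer1998, Luscher1982Topology, Aoki1984WilsonPhase, MohlerSchaefer2020, Wegner1981DensityOfStates
[crux] FRAME ∧ SEPARATOR LAW ALONG PINNED-DILUTE LINES (NEW 2026-08-17, route-repair on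
rattack-18065 — bridge 18065 refuted-misstated 'missing frame on hypothesis 2': this is the BY-NAME
carrier of that frame and the ∀-aligned item form of CoerciveOfDilute (14759) / of CoerciveSea
(13901) (i) that the CoerciveSea leads c2–c5 asked the planner to file; a NEW top-level decl (slots
freed by returning 14759 to support and dropping the pure-logic support DiluteOfEarlyCrossers)
because 13901/14759's texts are frozen by landed modules). Two ∀reg clauses about EVERY admissible
regularisation reg (HasMassScaling, two-loop HasAsymptoticScaling) of N_f ∈ {2,3} Wilson QCD: (α)
FRAME — if above some threshold M₀ ≥ 0 the Wilson determinant sign is PINNED FROM BOTH SIDES along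
reg (for every sea tuple m > M₀ some R > 0: for every M > M₀, eventually in k, under the
phase-quenched weight, P(Re det D_W(m_crit(k) − a_kM/Z_m(k)) < 0) ≥ 1/4 on every odd torus of
physical side ≥ R and P(Re det D_W(m_crit(k) + a_kM/Z_m(k)) < 0) ≤ 1/8 on odd tori of side in [R,
2R] — clauses (b) ∧ (b″) of EarlyCrosserLaw 13995 under one eventuality, `Filter.Eventually.and`,
Sketch.lean), then m_crit(k) → 0 (Filter.Tendst -/
@[route_item "route-QuantumFields-NestedDissectionSea", crux]
def FrameAndSeparatorLaw : Prop :=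
  open Literature.MathematicalPhysics.QuantumLattice Literature.MathematicalPhysics.QuantumFieldTheory Literature.Probability.LatticeModels in (∀ (Nf : ℕ) (reg : QCDRegularisation Nf), (Nf = 2 ∨ Nf = 3) → reg.HasMassScaling → (reg.scheme 0 0 0).HasAsymptoticScaling → ∀ M₀ : ℝ, 0 ≤ M₀ → (∀ m : Fin Nf → ℝ, (∀ f, M₀ < m f) → ∃ R : ℝ, 0 < R ∧ ∀ M : ℝ, M₀ < M → ∀ᶠ k : ℕ in Filter.atTop, ∀ S : ℕ, R ≤ reg.a k * (2 * S + 1) → let N : ℕ := 2 * S + 1; let mq : Fin Nf → ℝ := fun f => reg.mcrit k + reg.a k * m f / reg.Zm k; let wt : GaugeConfig 4 N (Matrix.specialUnitaryGroup (Fin 3) ℂ) → ℝ := fun U => ∏ f, ‖fermionDet (wilsonDirac (fundamentalRep (Fin 3)) U (mq f) 1)‖; let Pneg : ℝ → ℝ := fun μ => (∫ U, (if (fermionDet (wilsonDirac (fundamentalRep (Fin 3)) U μ 1)).re < 0 then (1 : ℝ) else 0) * wt U ∂(wilsonMeasure (d := 4) (L := N) (fundamentalRep (Fin 3)) (reg.β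 k))) / (∫ U, wt U ∂(wilsonMeasure (d := 4) (L := N) (fundamentalRep (Fin 3)) (reg.β k))); (1 / 4 : ℝ) ≤ Pneg (reg.mcrit k - reg.a k * M / reg.Zm k) ∧ (reg.a k * (2 * S + 1) ≤ 2 * R → Pneg (reg.mcrit k + reg.a k * M / reg.Zm k) ≤ (1 / 8 : ℝ))) → Filter.Tendsto reg.mcrit Filter.atTop (nhds 0)) ∧ (∀ (Nf : ℕ) (reg : QCDRegularisation Nf), (Nf = 2 ∨ Nf = 3) → reg.HasMassScaling → (reg.scheme 0 0 0).HasAsymptoticScaling → Filter.Tendsto reg.mcrit Filter.atTop (nhds 0) → ∀ M₀ : ℝ, 0 ≤ M₀ → ∀ b₀ : ℕ, 2 ≤ b₀ → ∀ ℓ : ℝ, 0 < ℓ → (∀ m : Fin Nf → ℝ, (∀ f, M₀ < m f) → ∃ R : ℝ, 0 < R ∧ (∀ ε : ℝ, 0 < ε → ∀ᶠ k : ℕ in Filter.atTop, ∀ S : ℕ, R ≤ reg.a k * (2 * S + 1) → let N : ℕ := 2 * S + 1; let mq : Fin Nf → ℝ := fun f => reg.mcrit k + reg.a k * m f / reg.Zm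 k; let wt : GaugeConfig 4 N (Matrix.specialUnitaryGroup (Fin 3) ℂ) → ℝ := fun U => ∏ f, ‖fermionDet (wilsonDirac (fundamentalRep (Fin 3)) U (mq f) 1)‖; let P : (GaugeConfig 4 N (Matrix.specialUnitaryGroup (Fin 3) ℂ) → Prop) → ℝ := fun E => (∫ U, (if E U then (1 : ℝ) else 0) * wt U ∂(wilsonMeasure (d := 4) (L := N) (fundamentalRep (Fin 3)) (reg.β k))) / (∫ U, wt U ∂(wilsonMeasure (d := 4) (L := N) (fundamentalRep (Fin 3)) (reg.β k))); let J : ℕ := Nat.log 2 (⌊ℓ / reg.a k⌋₊ / b₀) + 1; ∃ δ : ℕ → ℝ, ∑ j ∈ Finset.range J, δ j ≤ ε ∧ ∀ j < J, ∀ s : Fin 4 → ℕ, (∀ i, b₀ * 2 ^ j ≤ s i ∧ s i < b₀ * 2 ^ (j + 2) ∧ s i ≤ N ∧ (s i : ℝ) * reg.a k ≤ ℓ) → P (fun U => ∃ f, IsSignDefect U (mq f) j s) ≤ δ j) ∧ (∀ M : ℝ, M₀ < M → ∀ᶠ k : ℕ in Filter.atTop, ∀ S : ℕ, R ≤ reg.a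 k * (2 * S + 1) → let N : ℕ := 2 * S + 1; let mq : Fin Nf → ℝ := fun f => reg.mcrit k + reg.a k * m f / reg.Zm k; let wt : GaugeConfig 4 N (Matrix.specialUnitaryGroup (Fin 3) ℂ) → ℝ := fun U => ∏ f, ‖fermionDet (wilsonDirac (fundamentalRep (Fin 3)) U (mq f) 1)‖; (1 / 4 : ℝ) ≤ (∫ U, (if (fermionDet (wilsonDirac (fundamentalRep (Fin 3)) U (reg.mcrit k - reg.a k * M / reg.Zm k) 1)).re < 0 then (1 : ℝ) else 0) * wt U ∂(wilsonMeasure (d := 4) (L := N) (fundamentalRep (Fin 3)) (reg.β k))) / (∫ U, wt U ∂(wilsonMeasure (d := 4) (L := N) (fundamentalRep (Fin 3)) (reg.β k))))) → ∃ M₁ : ℝ, M₀ ≤ M₁ ∧ ∃ ℓ' : ℝ, 0 < ℓ' ∧ ℓ' ≤ ℓ ∧ ∀ m : Fin Nf → ℝ, (∀ f, M₁ < m f) → ∃ R : ℝ, 0 < R ∧ ∃ S₀ : ℕ, ∃ C : ℝ, 0 < C ∧ ∃ α : ℝ, 0 < α ∧ ∀ᶠ k : ℕ in Filter.atTop, ∀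 S : ℕ, R ≤ reg.a k * (2 * S + 1) → let N : ℕ := 2 * S + 1; let mq : Fin Nf → ℝ := fun f => reg.mcrit k + reg.a k * m f / reg.Zm k; let wt : GaugeConfig 4 N (Matrix.specialUnitaryGroup (Fin 3) ℂ) → ℝ := fun U => ∏ f, ‖fermionDet (wilsonDirac (fundamentalRep (Fin 3)) U (mq f) 1)‖; let P : (GaugeConfig 4 N (Matrix.specialUnitaryGroup (Fin 3) ℂ) → Prop) → ℝ := fun E => (∫ U, (if E U then (1 : ℝ) else 0) * wt U ∂(wilsonMeasure (d := 4) (L := N) (fundamentalRep (Fin 3)) (reg.β k))) / (∫ U, wt U ∂(wilsonMeasure (d := 4) (L := N) (fundamentalRep (Fin 3)) (reg.β k))); ∀ s : Fin 4 → ℕ, (∀ i, b₀ ≤ s i ∧ s i ≤ N ∧ (s i : ℝ) * reg.a k ≤ ℓ') → (∀ i, S₀ ≤ s i) → (∀ i j, s i ≤ 2 * s j) → ∀ f : Fin Nf, ∀ t : ℝ, 0 < t → t ≤ 1 → P (fun U => HasSingularSeparator U (mq f) s (t / s 0)) ≤ C * t ^ α)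

-- earlier RobustYangMillsRG (stmt-QuantumFields-14958, replaced 2026-08-17T02:18:22Z -> stmt-QuantumFields-18010): refuted by Summit.QuantumFields.QCD.Theorems.not_RobustYangMillsRG @ 42cbf9ef150e — open Literature.MathematicalPhysics.QuantumLattice Literature.MathematicalPhysics.AQFT Literature.MathematicalPhysics.QuantumFieldTheory in let G := ↥(Matrix.specialUnitaryGroup (Fin 3) ℂ); let ρ : G →* 
-- earlier RobustYangMillsRG (stmt-QuantumFields-18010, replaced 2026-08-17T02:27:45Z -> stmt-QuantumFields-17812): retired by None — open Literature.MathematicalPhysics.QuantumLattice Literature.MathematicalPhysics.AQFT Literature.MathematicalPhysics.QuantumFieldTheory in let G := ↥(Matrix.specialUnitaryGroup (Fin 3) ℂ); let ρ : G →* Matrix (Fin 3) (Fin 3) ℂ := fundamentalRep (Fin 3); let r₃ : Latti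
/-- item stmt-QuantumFields-17812 · crux · rank 4 · open · by planner
why it might fail: Open ⊇ volume-uniform gap of every weakly coupled coercive-format SU(3) block theory (universality of the gapped phase; no IR transfer tool); g-uniform (ε,r) vs Bałaban's α∼g(log g⁻²)^q; class may be empty if no fat coercive averaging is certified into the format.
sources: Balaban1988Convergent, Balaban1985Averaging, Balaban1984Propagators, Balaban1989LargeFieldII, Dimock2022QED3, DobrushinShlosman1987
[crux] RobustYangMillsRG — the NAMED CONDITION in its RG-level, consumable form, rev 3 (route-repair
2026-08-17 after the Lean refutation of rev 2, `not_RobustYangMillsRG`, class refuted-misstated: rev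
2 tied the principal part to the fibre-infimum A_Bl of an ∃-chosen blocking map constrained only by
measurability/covariance/locality, so a WILD measurable blocking (Haar→Haar shear, fibre infimum ≡
0) made the β = 0 Haar weight admissible for every β₀; the lead's repair-caveat showed `Continuous
Bl` still admits fixed-exponent cousins (label inflation), and the crux-ideate FINDINGS (A4 sub-ℓ₀
blindness, A5/F-E1 E1-dichotomy: hypercubic-anisotropic RP families are admissible iff the
consumers' format theorem holds, and then no SO(4)-invariant OSData is their limit) showed the
FINE/OS conclusions (i′),(ii) misstated for the class). REV 3 = refuter option (B) + block-level
conclusion: COERCIVE-FORMAT ROBUSTNESS OF THE GAPPED PHASE AT ONE BLOCK SCALE. For every choice of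
format constants (small-field threshold ε, analyticity radius r, remainder bound B₀ = O(1), decay
rate κ, rough-region allowance c₀, and NEW: coercivity constant cA and principal-norm bound A₀)
there is β₀ such that for -/
@[route_item "route-QuantumFields-NestedDissectionSea", crux]
def RobustYangMillsRG : Prop :=
  open Literature.MathematicalPhysics.QuantumLattice Literature.MathematicalPhysics.AQFT Literature.MathematicalPhysics.QuantumFieldTheory in let G := ↥(Matrix.specialUnitaryGroup (Fin 3) ℂ); let ρ : G →* Matrix (Fin 3) (Fin 3) ℂ := fundamentalRep (Fin 3); ∀ ε r B₀ κ c₀ cA A₀ : ℝ, 0 < ε → 0 < r → 0 < B₀ → 0 < κ → 0 < c₀ → 0 < cA → 0 < A₀ → ∃ β₀ : ℝ, 0 < β₀ ∧ ∀ (a : ℕ → ℝ) (L : ℕ → ℕ), (∀ k, 0 < a k) → Tendsto a atTop (nhds 0) → Tendsto (fun k => a k * L k) atTop atTop → ∀ ℓ₀ : ℝ, 0 < ℓ₀ → let b : ℕ → ℕ := fun k => ⌊ℓ₀ / a k⌋₊; let N : ℕ → ℕ := fun S => 2 * S + 1; let M : ℕ → ℕ → ℕ := fun k S => N S / b k - 1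 + 1; let cor : (k S : ℕ) → Site 4 (M k S) → Site 4 (N S) := fun k S y i => ((N S * (y i).val / M k S : ℕ) : ZMod (N S)); let μ : (n : ℕ) → [NeZero n] → Measure (GaugeConfig 4 n G) := fun _ _ => Measure.pi fun _ => haarProbability G; let LF : (k S : ℕ) → GaugeConfig 4 (M k S) G → Finset (Site 4 (M k S)) := fun _ _ V => Finset.univ.filter fun y => ∃ i j : Fin 4, ε < 3 - (ρ (plaquetteHolonomy V y i j)).trace.re; let AdmAt : ((k S : ℕ) → GaugeConfig 4 (N S) G → ℝ) → (ℕ → ℝ) → ((k S : ℕ) → GaugeConfig 4 (N S) G → GaugeConfig 4 (M k S) G) → ℕ → ℕ → Prop := fun w βe Bl k S => Measurable (w k S) ∧ (0 < ∫ U, w k S U ∂(μ (N S))) ∧ (∀ g U, w k S (gaugeTransform g U) = w k S U) ∧ (∀ v U, w k S (torusConfigShift v U) = w k S U) ∧ (∀ U, w k S (GaugeConfig.timeReflect U) = w k S U) ∧ (∀ (π : Equiv.Perm (Fin 4)) U, w k S (U ∘ fun e => (e.1 ∘ π, π.symm e.2)) = w k S U) ∧ (∀ F : GaugeConfig 4 (N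 S) G → ℝ, Measurable F → (∃ C, ∀ U, |F U| ≤ C) → IsPositiveTimeObservable F → 0 ≤ ∫ U, F U.timeReflect * F U * w k S U ∂(μ (N S))) ∧ Measurable (Bl k S) ∧ (∀ g U, Bl k S (gaugeTransform g U) = gaugeTransform (g ∘ cor k S) (Bl k S U)) ∧ (∀ e, DependsOn (fun U => Bl k S U e) {e' | ∀ i, (e'.1 i - cor k S e.1 i).val ≤ 5 * b k ∨ (cor k S e.1 i - e'.1 i).val ≤ 5 * b k}) ∧ ∃ (A W : QuasiLocalGaugePerturbation 4 (M k S) G 1) (F : Finset (Site 4 (M k S)) → GaugeConfig 4 (M k S) G → ℝ), A.HasAnalyticNormLE ρ (smallFieldDomain ρ 1 r ε) κ A₀ ∧ A.NormLE κ A₀ ∧ (∀ X ∈ polymers 1, (∃ V, A.act X V ≠ 0) → ∀ y ∈ X, ∀ y' ∈ X, ∀ i, (y i - y' i).val ≤ X.card ∨ (y' i - y i).val ≤ X.card) ∧ (∀ V, cA * wilsonAction ρ V ≤ A.total V - A.total fun _ => 1) ∧ W.HasAnalyticNormLE ρ (smallFieldDomain ρ 1 r ε) κ B₀ ∧ W.NormLE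 κ B₀ ∧ (∀ X ∈ polymers 1, (∃ V, W.act X V ≠ 0) → ∀ y ∈ X, ∀ y' ∈ X, ∀ i, (y i - y' i).val ≤ X.card ∨ (y' i - y i).val ≤ X.card) ∧ (∀ Z, Measurable (F Z)) ∧ (∀ V, F ∅ V = 1) ∧ (∀ Z V, |F Z V| ≤ Real.exp (c₀ * Z.card)) ∧ (∀ Z (n : ℕ) V V', (∀ e, (∃ y ∈ Z, ∀ i, (e.1 i - y i).val ≤ n ∨ (y i - e.1 i).val ≤ n) → V e = V' e) → |F Z V - F Z V'| ≤ Real.exp (c₀ * Z.card + κ * (4 - n))) ∧ (∀ Z₁ Z₂ (n : ℕ), (∀ y ∈ Z₁, ∀ y' ∈ Z₂, ∃ i, n < (y i - y' i).val ∧ n < (y' i - y i).val) → ∀ V, |F (Z₁ ∪ Z₂) V - F Z₁ V * F Z₂ V| ≤ Real.exp (c₀ * (Z₁.card + Z₂.card) + κ * (4 - n))) ∧ ∀ Gf, Measurable Gf → (∃ C, ∀ V, |Gf V| ≤ C) → ∫ U, Gf (Bl k S U) * w k S U ∂(μ (N S)) = ∫ V, Gf V * (Real.exp (-(βe k * A.total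 V) - W.total V) * F (LF k S V) V) ∂(μ (M k S)); ∀ (w : (k S : ℕ) → GaugeConfig 4 (N S) G → ℝ) (βe : ℕ → ℝ) (Bl : (k S : ℕ) → GaugeConfig 4 (N S) G → GaugeConfig 4 (M k S) G), (∃ βl, Tendsto βe atTop (nhds βl)) → (∀ᶠ k in atTop, β₀ ≤ βe k ∧ ∀ S, L k ≤ S → AdmAt w βe Bl k S) → let E : (k S : ℕ) → (GaugeConfig 4 (N S) G → ℝ) → ℝ := fun k S h => (∫ U, h U * w k S U ∂(μ (N S))) / ∫ U, w k S U ∂(μ (N S)); ∃ Δ : ℝ, 0 < Δ ∧ ∀ h : ℕ, ∃ C : ℝ, ∀ᶠ k in atTop, ∀ S, L k ≤ S → ∀ (t : ℕ) (G₁ G₂ : GaugeConfig 4 (M k S) G → ℝ) (C₁ C₂ : ℝ), 2 * t ≤ M k S → Measurable G₁ → Measurable G₂ → (∀ V, |G₁ V| ≤ C₁) → (∀ V, |G₂ V| ≤ C₂) → DependsOn G₁ {e | (e.1 0).val < h} → DependsOn G₂ {e | (e.1 0).val < h} → |E k S (fun U => G₁ (Bl k S U) * G₂ (torusConfigShift (Pi.single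 0 (t : ZMod (M k S))) (Bl k S U))) - E k S (fun U => G₁ (Bl k S U)) * E k S (fun U => G₂ (torusConfigShift (Pi.single 0 (t : ZMod (M k S))) (Bl k S U)))| ≤ C * C₁ * C₂ * Real.exp (-(Δ * (ℓ₀ * t)))

-- earlier SeaFactorisationBridge (stmt-QuantumFields-11273, replaced 2026-08-15T22:40:02Z -> stmt-QuantumFields-13902): retired by None — CoerciveSea → ∀ Nf : ℕ, (Nf = 2 ∨ Nf = 3) → ∃ M₀ : ℝ, 0 ≤ M₀ ∧ ∃ reg : Literature.MathematicalPhysics.QuantumFieldTheory.QCDRegularisation Nf, reg.HasMassScaling ∧ ∀ m : Fin Nf → ℝ, (∀ f, M₀ < m f) → ∃ (z shift : Literature.MathematicalPhysics.QuantumFieldTheory.Q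
-- earlier SeaFactorisationBridge (stmt-QuantumFields-13880, replaced 2026-08-16T23:27:11Z -> stmt-QuantumFields-17683): retired by None — RobustYangMills → CoerciveSea → ∀ Nf : ℕ, Nf = 2 ∨ Nf = 3 → ∃ M₀ : ℝ, 0 ≤ M₀ ∧ ∃ reg : Literature.MathematicalPhysics.QuantumFieldTheory.QCDRegularisation Nf, reg.HasMassScaling ∧ ∀ m : Fin Nf → ℝ, (∀ f, M₀ < m f) → ∃ (z shift : Literature.MathematicalPhysics.Quan
-- earlier SeaFactorisationBridge (stmt-QuantumFields-13902, replaced 2026-08-15T22:43:40Z -> stmt-QuantumFields-13880): retired by None — RobustYangMills → CoerciveSea → ThresholdQCD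
-- earlier SeaFactorisationBridge (stmt-QuantumFields-17683, replaced 2026-08-16T23:28:06Z -> stmt-QuantumFields-17705): retired by None — CoerciveSea → ∀ Nf : ℕ, (Nf = 2 ∨ Nf = 3) → QCDOf Nf
-- earlier SeaFactorisationBridge (stmt-QuantumFields-17705, replaced 2026-08-17T00:05:39Z -> stmt-QuantumFields-18065): retired by None — open Literature.MathematicalPhysics.QuantumLattice Literature.MathematicalPhysics.QuantumFieldTheory Literature.Probability.LatticeModels in RobustYangMillsRG → CoerciveSea → ∀ Nf : ℕ, (Nf = 2 ∨ Nf = 3) → ∃ reg : QCDRegularisation Nf, reg.HasMassScaling ∧ (reg.sch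
-- earlier SeaFactorisationBridge (stmt-QuantumFields-18065, replaced 2026-08-17T01:01:46Z -> stmt-QuantumFields-17010): retired by None — open Literature.MathematicalPhysics.QuantumLattice Literature.MathematicalPhysics.QuantumFieldTheory Literature.Probability.LatticeModels in RobustYangMillsRG → CoerciveSea → ∀ Nf : ℕ, (Nf = 2 ∨ Nf = 3) → ∃ reg : QCDRegularisation Nf, reg.HasMassScaling ∧ (reg.sch
/-- item stmt-QuantumFields-17010 · crux · rank 5 · open · by planner
why it might fail: One-block COERCIVE Bałaban format for the signed sea at ℓ₀=c/M₀ undone; #4 rev 3 (17812) being BLOCK-level, the bridge also owes fine-from-block clustering, the OS limit of all QCD species (UV stability with fermions), non-triviality, E1 via import 8840; KP sign transfer; (β) only on large boxes.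
sources: Balaban1988Convergent, Balaban1989LargeFieldII, Balaban1985Averaging, BalabanOcarrollSchor1989, Dimock2022QED3, KoteckyPreiss1986
[crux] THE THRESHOLD BRIDGE OVER FRAMED, BY-NAME HYPOTHESES (route-repair 2026-08-17 on the
crux-attack rattack-18065, refuted-misstated 'missing frame on hypothesis 2': the old hypothesis
CoerciveSea (13901) is an ∃reg with no branch clause and no upper pin, certified only into (−8+aM/Z,
aM/Z) (PinWindow.mass_mem_Ioo, PinUpperBranch p93744, RegPrefixOffBranch p73529,
WindowDefectFloorIffBranch), while the conclusion demands a framed output reg (eventually m_crit ≥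
−1, two-sided pin; W.lean ConclAt.frame), so any proof had to derive reg_C's frame — a χ_t>0-type
converse sea lemma in neither hypothesis — or discard reg_C (hinge idle ⇒ crux ⊇ the whole sea
side): Death 1 of all three 13880 lines. The refuter's C′ framed hypothesis 2 (CoerciveSeaFramed, or
13901/13900/13995 restated per tenure action R2); those texts are types in ~60 landed modules, so
the frame is supplied BY NAME instead: THE LINE EarlyCrosserLaw (13995, the only decl carrying the
two-sided pin (b),(b″)) hands over ITS OWN regularisation reg, and the new ∀reg crux
FrameAndSeparatorLaw frames it — (α) two-sided pin above a threshold ⇒ Filter.Tendsto reg.mcrit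
atTop (nhds 0) — and makes it coercive — (β) the separator -/
@[route_item "route-QuantumFields-NestedDissectionSea", crux]
def SeaFactorisationBridge : Prop :=
  open Literature.MathematicalPhysics.QuantumLattice Literature.MathematicalPhysics.QuantumFieldTheory Literature.Probability.LatticeModels in RobustYangMillsRG → EarlyCrosserLaw → FrameAndSeparatorLaw → ∀ Nf : ℕ, (Nf = 2 ∨ Nf = 3) → ∃ reg : QCDRegularisation Nf, reg.HasMassScaling ∧ (reg.scheme 0 0 0).HasAsymptoticScaling ∧ (∀ᶠ k : ℕ in Filter.atTop, -1 ≤ reg.mcrit k) ∧ ∃ M₀ : ℝ, 0 ≤ M₀ ∧ (∀ m : Fin Nf → ℝ, (∀ f, M₀ < m f) → ∃ R : ℝ, 0 < R ∧ (∀ M : ℝ, M₀ < M → ∀ᶠ k : ℕ in Filter.atTop, ∀ S : ℕ, R ≤ reg.a k * (2 * S + 1) → let N : ℕ := 2 * S + 1; let mq : Fin Nf → ℝ := fun f => reg.mcrit k + reg.a k * m f / reg.Zm k; let wt : GaugeConfig 4 N (Matrix.specialUnitaryGroup (Fin 3) ℂ) → ℝ := fun U => ∏ f, ‖fermionDet (wilsonDirac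 (fundamentalRep (Fin 3)) U (mq f) 1)‖; (1 / 4 : ℝ) ≤ (∫ U, (if (fermionDet (wilsonDirac (fundamentalRep (Fin 3)) U (reg.mcrit k - reg.a k * M / reg.Zm k) 1)).re < 0 then (1 : ℝ) else 0) * wt U ∂(wilsonMeasure (d := 4) (L := N) (fundamentalRep (Fin 3)) (reg.β k))) / (∫ U, wt U ∂(wilsonMeasure (d := 4) (L := N) (fundamentalRep (Fin 3)) (reg.β k)))) ∧ (∀ M : ℝ, M₀ < M → ∀ᶠ k : ℕ in Filter.atTop, ∀ S : ℕ, R ≤ reg.a k * (2 * S + 1) → reg.a k * (2 * S + 1) ≤ 2 * R → let N : ℕ := 2 * S + 1; let mq : Fin Nf → ℝ := fun f => reg.mcrit k + reg.a k * m f / reg.Zm k; let wt : GaugeConfig 4 N (Matrix.specialUnitaryGroup (Fin 3) ℂ) → ℝ := fun U => ∏ f, ‖fermionDet (wilsonDirac (fundamentalRep (Fin 3)) U (mq f) 1)‖; (∫ U, (if (fermionDet (wilsonDirac (fundamentalRep (Fin 3)) U (reg.mcrit k + reg.a k * M / reg.Zm k) 1)).re < 0 then (1 : ℝ) else 0) *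 wt U ∂(wilsonMeasure (d := 4) (L := N) (fundamentalRep (Fin 3)) (reg.β k))) / (∫ U, wt U ∂(wilsonMeasure (d := 4) (L := N) (fundamentalRep (Fin 3)) (reg.β k))) ≤ (1 / 8 : ℝ))) ∧ ∀ m : Fin Nf → ℝ, (∀ f, M₀ < m f) → ∃ (z shift : QCDField Nf → ℕ → ℝ) (T : OSData (QCDField Nf) 4), IsQCDAlong (reg.scheme m z shift) T ∧ T.IsNontrivial QCDField.glue ∧ T.IsNonGaussian QCDField.glue ∧ (∀ f g : Fin Nf, f ≠ g → T.IsNontrivial (QCDField.pseudoRe f g)) ∧ ∃ Δ > 0, T.HasMassGap Δ ∧ (reg.scheme m z shift).HasLatticeMassGap Δ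

/-- item stmt-QuantumFields-18066 · crux · rank 6 · open · by planner
why it might fail: Contains the light-quark completion: false if the jump band keeps RGI width ↛ 0 (first-order metastability), if light masses meet an Aoki/first-order artefact eventually in k, if the full-spectrum lattice gap cannot be continued below M₀, or if a pinned reg stays uniformly gapped as m → 0⁺.
sources: SharpeSingleton1998, Aoki1984WilsonPhase, GoltermanShamirSvetitsky2005, GoltermanShamir2003, EdwardsHellerNarayanan1998, GasserLeutwyler1984
[crux] THE LIGHT-QUARK NODE (route-repair 2026-08-17: restates JumpLineIsChiral
stmt-QuantumFields-17706 1:1 as the refuter's NAMED LIGHT-RANGE crux (B2) joined to the chirality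
crux (J), to be SPLIT (glued) into the children ZeroThresholdDescent (B2) and JumpLineIsChiral (J,
verbatim the rev-26 statement) with pure-logic glue B2 → J → this (Sketch.lean) — so the refuter's
three pieces B1 | B2 | J are separately staffed within the D-0019 top-level caps). For N_f ∈ {2,3}:
EVERY mass-independent regularisation reg such as the threshold bridge SeaFactorisationBridge
outputs — HasMassScaling, two-loop HasAsymptoticScaling, weak branch (eventually m_crit(k) ≥ −1), a
threshold M₀ ≥ 0, the two-sided parity pin above M₀ (for every sea tuple m > M₀ some R > 0: for
every M > M₀, eventually in k, P(Re det D_W(m_crit − a_kM/Z_m) < 0) ≥ 1/4 on odd tori of side ≥ R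
and P(Re det D_W(m_crit + a_kM/Z_m) < 0) ≤ 1/8 on odd tori of side in [R, 2R], phase-quenched
weight) and the full QCDOf body at every tuple m > M₀ — admits a regularisation reg′ (INTENDED: reg
re-pinned at its own parity-jump line, m′_crit = m_crit + a_kδ/Z_m, possibly along a subsequence and
with adjusted volumes; stated as a fresh -/
@[route_item "route-QuantumFields-NestedDissectionSea", crux]
def LightQuarkCompletion : Prop :=
  open Literature.MathematicalPhysics.QuantumLattice Literature.MathematicalPhysics.QuantumFieldTheory Literature.Probability.LatticeModels in ∀ Nf : ℕ, (Nf = 2 ∨ Nf = 3) → ∀ reg : QCDRegularisation Nf, reg.HasMassScaling → (reg.scheme 0 0 0).HasAsymptoticScaling → (∀ᶠ k : ℕ in Filter.atTop, -1 ≤ reg.mcrit k) → ∀ M₀ : ℝ, 0 ≤ M₀ → (∀ m : Fin Nf → ℝ, (∀ f, M₀ < m f) → ∃ R : ℝ, 0 < R ∧ (∀ M : ℝ, M₀ < M → ∀ᶠ k : ℕ in Filter.atTop, ∀ S : ℕ, R ≤ reg.a k * (2 * S + 1) → let N : ℕ := 2 * S + 1; let mq : Fin Nf → ℝ := fun f =>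 reg.mcrit k + reg.a k * m f / reg.Zm k; let wt : GaugeConfig 4 N (Matrix.specialUnitaryGroup (Fin 3) ℂ) → ℝ := fun U => ∏ f, ‖fermionDet (wilsonDirac (fundamentalRep (Fin 3)) U (mq f) 1)‖; (1 / 4 : ℝ) ≤ (∫ U, (if (fermionDet (wilsonDirac (fundamentalRep (Fin 3)) U (reg.mcrit k - reg.a k * M / reg.Zm k) 1)).re < 0 then (1 : ℝ) else 0) * wt U ∂(wilsonMeasure (d := 4) (L := N) (fundamentalRep (Fin 3)) (reg.β k))) / (∫ U, wt U ∂(wilsonMeasure (d := 4) (L := N) (fundamentalRep (Fin 3)) (reg.β k)))) ∧ (∀ M : ℝ, M₀ < M → ∀ᶠ k : ℕ in Filter.atTop, ∀ S : ℕ, R ≤ reg.a k * (2 * S + 1) → reg.a k * (2 * S + 1) ≤ 2 * R → let N : ℕ := 2 * S + 1; let mq : Fin Nf → ℝ := fun f => reg.mcrit k + reg.a k * m f / reg.Zm k; let wt : GaugeConfig 4 N (Matrix.specialUnitaryGroup (Fin 3) ℂ) → ℝ := fun U => ∏ f, ‖fermionDet (wilsonDirac (fundamentalRep (Fin 3)) U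 (mq f) 1)‖; (∫ U, (if (fermionDet (wilsonDirac (fundamentalRep (Fin 3)) U (reg.mcrit k + reg.a k * M / reg.Zm k) 1)).re < 0 then (1 : ℝ) else 0) * wt U ∂(wilsonMeasure (d := 4) (L := N) (fundamentalRep (Fin 3)) (reg.β k))) / (∫ U, wt U ∂(wilsonMeasure (d := 4) (L := N) (fundamentalRep (Fin 3)) (reg.β k))) ≤ (1 / 8 : ℝ))) → (∀ m : Fin Nf → ℝ, (∀ f, M₀ < m f) → ∃ (z shift : QCDField Nf → ℕ → ℝ) (T : OSData (QCDField Nf) 4), IsQCDAlong (reg.scheme m z shift) T ∧ T.IsNontrivial QCDField.glue ∧ T.IsNonGaussian QCDField.glue ∧ (∀ f g : Fin Nf, f ≠ g → T.IsNontrivial (QCDField.pseudoRe f g)) ∧ ∃ Δ > 0, T.HasMassGap Δ ∧ (reg.scheme m z shift).HasLatticeMassGap Δ) → ∃ reg' : QCDRegularisation Nf, reg'.HasMassScaling ∧ (reg'.scheme 0 0 0).HasAsymptoticScaling ∧ Filter.Tendsto reg'.mcrit Filter.atTop (nhds 0) ∧ (∀ m : Fin Nf → ℝ, (∀ f, 0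 < m f) → ∃ R : ℝ, 0 < R ∧ (∀ M : ℝ, 0 < M → ∀ᶠ k : ℕ in Filter.atTop, ∀ S : ℕ, R ≤ reg'.a k * (2 * S + 1) → let N : ℕ := 2 * S + 1; let mq : Fin Nf → ℝ := fun f => reg'.mcrit k + reg'.a k * m f / reg'.Zm k; let wt : GaugeConfig 4 N (Matrix.specialUnitaryGroup (Fin 3) ℂ) → ℝ := fun U => ∏ f, ‖fermionDet (wilsonDirac (fundamentalRep (Fin 3)) U (mq f) 1)‖; (1 / 4 : ℝ) ≤ (∫ U, (if (fermionDet (wilsonDirac (fundamentalRep (Fin 3)) U (reg'.mcrit k - reg'.a k * M / reg'.Zm k) 1)).re < 0 then (1 : ℝ) else 0) * wt U ∂(wilsonMeasure (d := 4) (L := N) (fundamentalRep (Fin 3)) (reg'.β k))) / (∫ U, wt U ∂(wilsonMeasure (d := 4) (L := N) (fundamentalRep (Fin 3)) (reg'.β k)))) ∧ (∀ M : ℝ, 0 < M → ∀ᶠ k : ℕ in Filter.atTop, ∀ S : ℕ, R ≤ reg'.a k * (2 * S + 1) → reg'.a k * (2 * S + 1) ≤ 2 * R → let N : ℕ := 2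 * S + 1; let mq : Fin Nf → ℝ := fun f => reg'.mcrit k + reg'.a k * m f / reg'.Zm k; let wt : GaugeConfig 4 N (Matrix.specialUnitaryGroup (Fin 3) ℂ) → ℝ := fun U => ∏ f, ‖fermionDet (wilsonDirac (fundamentalRep (Fin 3)) U (mq f) 1)‖; (∫ U, (if (fermionDet (wilsonDirac (fundamentalRep (Fin 3)) U (reg'.mcrit k + reg'.a k * M / reg'.Zm k) 1)).re < 0 then (1 : ℝ) else 0) * wt U ∂(wilsonMeasure (d := 4) (L := N) (fundamentalRep (Fin 3)) (reg'.β k))) / (∫ U, wt U ∂(wilsonMeasure (d := 4) (L := N) (fundamentalRep (Fin 3)) (reg'.β k))) ≤ (1 / 8 : ℝ))) ∧ reg'.IsChiralAtZero ∧ ∀ m : Fin Nf → ℝ, (∀ f, 0 < m f) → ∃ (z shift : QCDField Nf → ℕ → ℝ) (T : OSData (QCDField Nf) 4), IsQCDAlong (reg'.scheme m z shift) T ∧ T.IsNontrivial QCDField.glue ∧ T.IsNonGaussian QCDField.glue ∧ (∀ f g : Fin Nf, f ≠ g → T.IsNontrivial (QCDField.pseudoRe f g)) ∧ ∃ Δ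 > 0, T.HasMassGap Δ ∧ (reg'.scheme m z shift).HasLatticeMassGap Δ

/-- item stmt-QuantumFields-11274 · support · rank 9 · closed · proved by Summit.QuantumFields.QCD.Theorems.schurCellStep_proof (prover) · by planner
sources: George1973, CeGiustiSchaefer2017
[support] one nested-dissection step for a Wilson cell (card P1): on the torus of side N, for every
SU(3) field, bare mass and open box of sides s ≤ N at corner 0, (a) the block of the Dirichlet cell
matrix on the union of the 16 children interiors is block-diagonal — its determinant is the product
of the children's Dirichlet determinants (no Wilson hop crosses a sheet) — and (b) if that block is
invertible, det(cell) = det(children block) · det(Schur complement onto the internal separator)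
(Mathlib `Matrix.det_fromBlocks₁₁` after `Matrix.det_toBlock`). [difficulty: provable-now] -/
@[route_item "route-QuantumFields-NestedDissectionSea"]
def SchurCellStep : Prop :=
  open Literature.MathematicalPhysics.QuantumLattice Literature.MathematicalPhysics.QuantumFieldTheory Literature.Probability.LatticeModels in ∀ (N : ℕ) [NeZero N] (U : GaugeConfig 4 N (Matrix.specialUnitaryGroup (Fin 3) ℂ)) (μ : ℝ) (s : Fin 4 → ℕ), (∀ i, s i ≤ N) → let box : TorusSite 4 N → (Fin 4 → ℕ) → (TorusSite 4 N × Fin 3 × Fin 4) → Prop := fun x t p => ∀ i, 0 < (p.1 i - x i).val ∧ (p.1 i - x i).val < t i; let hc : (Fin 4 → Bool) → TorusSite 4 N := fun ε i => if ε i then ((s i / 2 : ℕ) : ZMod N) else 0; let hs : (Fin 4 → Bool) → (Fin 4 → ℕ) := fun ε i => if ε i then s i - s i / 2 else s i / 2; let D : Matrix (TorusSite 4 N × Fin 3 × Fin 4) (TorusSite 4 N × Fin 3 × Fin 4) ℂ := wilsonDirac (fundamentalRep (Fin 3)) U μ 1; let Dc := Matrix.toSquareBlockProp D (box 0 s); let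 inner : {p // box 0 s p} → Prop := fun p => ∃ ε, box (hc ε) (hs ε) p.1; (Dc.toBlock inner inner).det = ∏ ε : Fin 4 → Bool, (Matrix.toSquareBlockProp D (box (hc ε) (hs ε))).det ∧ (IsUnit (Dc.toBlock inner inner).det → Dc.det = (Dc.toBlock inner inner).det * (Dc.toBlock (fun p => ¬ inner p) (fun p => ¬ inner p) - Dc.toBlock (fun p => ¬ inner p) inner * (Dc.toBlock inner inner)⁻¹ * Dc.toBlock inner (fun p => ¬ inner p)).det)

/-- item stmt-QuantumFields-11275 · support · rank 9 · closed · proved by Summit.QuantumFields.QCD.Theorems.dirichletDetReal_proof (prover) · by planner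
sources: MontvayMunster1994
[support] every Dirichlet cell determinant of the r = 1 Wilson–Dirac matrix in the fundamental SU(3)
representation is real: γ₅-hermiticity (tree `wilsonDirac_gammaFive_hermitian_holds`) commutes with
restriction to a site set because `spinorLift gammaFive` is diagonal (`gammaFive_eq_diagonal`).
[difficulty: provable-now] -/
@[route_item "route-QuantumFields-NestedDissectionSea"]
def DirichletDetReal : Prop :=
  open Literature.MathematicalPhysics.QuantumLattice Literature.MathematicalPhysics.QuantumFieldTheory Literature.Probability.LatticeModels in ∀ (N : ℕ) [NeZero N] (U : GaugeConfig 4 N (Matrix.specialUnitaryGroup (Fin 3) ℂ)) (μ : ℝ) (c : Set (TorusSite 4 N)), (Matrix.toSquareBlockProp (wilsonDirac (fundamentalRep (Fin 3)) U μ 1) (fun p : TorusSite 4 N × Fin 3 × Fin 4 => p.1 ∈ c)).det.im = 0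

/-- item stmt-QuantumFields-11276 · support · rank 9 · closed · proved by Summit.QuantumFields.QCD.Theorems.diluteOfCoercive_proof @ 0c1e476ca277 (prover) · by planner
sources: MohlerSchaefer2020
[support] the hinge projects onto the rank-2 crux (clauses (ii)–(iii) of CoerciveSea are
NegativeCellsDilute verbatim; term-checked in the planner's Sketch.lean) — records that refuting
NegativeCellsDilute refutes CoerciveSea. [difficulty: provable-now] -/
@[route_item "route-QuantumFields-NestedDissectionSea"]
def DiluteOfCoercive : Prop :=
  CoerciveSea → NegativeCellsDilute

/-- item stmt-QuantumFields-13898 · support · rank 9 · closed · proved by Summit.QuantumFields.QCD.Theorems.signDefectForcesCrossing_proof (prover) · by planner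
sources: EdwardsHellerNarayanan1998, MohlerSchaefer2020, Literature.MathematicalPhysics.QuantumFieldTheory.wilsonDirac_mass_eq_add_scalar
[support] provable now (first lemma of the early-crosser mechanism): if the corner-0 box of sides s
is a sign defect at bare mass μ (IsSignDefect: leaf Dirichlet determinant negative at j = 0; parent
× 16 children negative at j ≥ 1), then some Dirichlet cell among {parent, 16 children} has a ZERO
MODE at a bare mass μ' ≥ μ, i.e. a real eigenvalue of its massless cell operator has CROSSED at or
above the valence mass. Proof: wilsonCell U μ' x s = μ'·1 + B (the mass is a diagonal shift,
`wilsonDirac_mass_eq_add_scalar` restricted), each determinant is a real (DirichletDetReal) monic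
polynomial in μ', positive for μ' → +∞; a negative value/product at μ forces a zero of one factor on
[μ, ∞) by the intermediate value theorem. Consequence used by NegativeCellsDilute: the sign carriers
at the valence mass m_crit + a m/Z are exactly the EARLY CROSSERS (modes crossing above the line),
never the deep supercritical crossings of EHN region II. [difficulty: provable-now, size M] -/
@[route_item "route-QuantumFields-NestedDissectionSea"]
def SignDefectForcesCrossing : Prop :=
  open Literature.MathematicalPhysics.QuantumLattice Literature.MathematicalPhysics.QuantumFieldTheory Literature.Probability.LatticeModels in ∀ (N : ℕ) [NeZero N] (U : GaugeConfig 4 N (Matrix.specialUnitaryGroup (Fin 3) ℂ)) (μ : ℝ) (j : ℕ) (s : Fin 4 → ℕ), IsSignDefect U μ j s → ∃ μ' : ℝ, μ ≤ μ' ∧ ((wilsonCell U μ' 0 s).det = 0 ∨ ∃ ε : Fin 4 → Bool, (wilsonCell U μ' (halfCorner s ε) (halfSides s ε)).det = 0)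

/-- item stmt-QuantumFields-13899 · support · rank 9 · closed · proved by Summit.QuantumFields.QCD.Theorems.kineticEdge_proof (prover) · by planner
sources: HernandezJansenLuscher1999, Neuberger2000, EdwardsHellerNarayanan1998, Sint1994
[support] provable now (the deterministic lever): KINETIC EDGE of Dirichlet Wilson cells. (a) If the
cell of corner x and sides s ≤ N has a zero mode at bare mass μ' (det wilsonCell U μ' x s = 0) then
−μ' ≥ Σ_i (1 − cos(π/s_i)): a kernel vector w has Re⟨w, D_c w⟩ = 0, i.e. covariant kinetic energy
⟨w, (4 − A_U)w⟩ = −μ'‖w‖² where A_U = ½(K + K†) = ½Σ_μ(U_μT_μ + h.c.) ⊗ 1_spin is the spin-blind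
covariant hopping; the lattice diamagnetic inequality ⟨w, A_U w⟩ ≤ ⟨|w|, A_1|w|⟩ and the top
eigenvalue Σ_i cos(π/s_i) of the free hopping on the open box (product of paths with s_i − 1 sites)
give the edge. (b) The same for near-singular separators: HasSingularSeparator U μ s τ with τ ≥ 0
gives ‖D_c w‖ < τ‖w‖ for the harmonic extension, hence Σ_i(1 − cos(π/s_i)) < τ − μ. Consequences
(numbers, every gauge field): no cell has a crossing at μ' ≥ 0; at the valence mass μ ≈ m_crit(β) <
0 cubic cells of side s < π(2/(|μ|+τ))^{1/2} carry NO sign defect and have τ-coercive separators —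
side ≤ 4 at β_W = 6.0 (κ_c = 0.157, |m_c| = 0.82), and since |m_crit(β)| ≍ 0.43 g₀²·(4/3)… → 0 the
defect-free range grows like β^{1/2}; any crossing mode at or above m_c at CLS couplings (β_W = 3.4,
|m_c| = 0.345) sp -/
@[route_item "route-QuantumFields-NestedDissectionSea"]
def KineticEdge : Prop :=
  open Literature.MathematicalPhysics.QuantumLattice Literature.MathematicalPhysics.QuantumFieldTheory Literature.Probability.LatticeModels in ∀ (N : ℕ) [NeZero N] (U : GaugeConfig 4 N (Matrix.specialUnitaryGroup (Fin 3) ℂ)) (s : Fin 4 → ℕ), (∀ (μ' : ℝ) (x : TorusSite 4 N), (∀ i, s i ≤ N) → (wilsonCell U μ' x s).det = 0 → ∑ i, (1 - Real.cos (Real.pi / s i)) ≤ -μ') ∧ (∀ (μ τ : ℝ), 0 ≤ τ → (∀ i, s i ≤ N) → HasSingularSeparator U μ s τ → ∑ i, (1 - Real.cos (Real.pi / s i)) < τ - μ)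

/-- item stmt-QuantumFields-13994 · support · rank 9 · closed · proved by Summit.QuantumFields.QCD.Theorems.chiralityPairing_proof @ ee6b69cd4bf5 (prover) · by planner
sources: MohlerSchaefer2020, EdwardsHellerNarayananInstanton1998, TrefethenEmbree2005, MontvayMunster1994
[support] provable-now (size M–L; linear algebra): CHIRALITY PAIRING — the typed anchor of the
lever's exact part E3 (MECHANISM-g2.md). If 0 is a SIMPLE eigenvalue of the Dirichlet Wilson cell
wilsonCell U μ′ x s (root multiplicity 1 of its characteristic polynomial at 0) and w ≠ 0 is a
kernel vector, then ⟨w, γ₅ w⟩ = Σ_p conj(w_p)·(γ₅)_{α_p α_p}·w_p ≠ 0 (γ₅ = diag(1,1,−1,−1),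
gammaFive_eq_diagonal). Proof: γ₅-hermiticity passes to principal submatrices because Γ₅ =
spinorLift gammaFive is site/colour-diagonal (wilsonDirac_gammaFive_hermitian_holds; the ingredient
of DirichletDetReal), so D_c† = Γ₅D_cΓ₅ and Γ₅w spans ker D_c† = (range D_c)^⊥; if ⟨Γ₅w, w⟩ = 0 then
w ∈ range D_c ∩ ker D_c, which is {0} when the algebraic multiplicity of 0 is 1 (Fitting: ker D_c =
ker D_cⁿ, range D_c = range D_cⁿ, ℂⁿ = ker ⊕ range) — contradiction. Meaning: |⟨w,γ₅w⟩|/‖w‖² =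
1/κ(0), the inverse Wilkinson condition number of the crossing — 'chirality of a real Wilson mode'
is lattice-exact and measures its robustness; with the Hellmann–Feynman formula λ′ =
⟨w,γ₅W′w⟩/⟨w,γ₅w⟩ (same pairing) it is the LAW OF MOTION of crossings: real eigenvalues are
born/annihilated only in pairs at chirality 0, chiral (to -/
@[route_item "route-QuantumFields-NestedDissectionSea"]
def ChiralityPairing : Prop :=
  open Literature.MathematicalPhysics.QuantumLattice Literature.MathematicalPhysics.QuantumFieldTheory Literature.Probability.LatticeModels in ∀ (N : ℕ) [NeZero N] (U : GaugeConfig 4 N (Matrix.specialUnitaryGroup (Fin 3) ℂ)) (μ' : ℝ) (x : TorusSite 4 N) (s : Fin 4 → ℕ) (w : {p // wilsonBox x s p} → ℂ), w ≠ 0 → (wilsonCell U μ' x s).mulVec w = 0 → (wilsonCell U μ' x s).charpoly.rootMultiplicity 0 = 1 → (∑ p, star (w p) * gammaFive p.1.2.2 p.1.2.2 * w p) ≠ 0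

/-- item stmt-QuantumFields-14759 · support · rank 9 · open · by planner
why it might fail: = CoerciveSea (i) along the dilution-certified reg: false if sheet-trapped near-real cell modes at the valence line have density ≳ a_k³s/ℓ³ per site (Golterman–Shamir localised modes; pair-born real modes with an Aoki-type band ∝ a), or if the window top feels O(1) coupling g²(ℓ).
sources: Wegner1981DensityOfStates, FrohlichSpencer1983, GoltermanShamir2003, MohlerSchaefer2020
[support] GLUE onto the deciding chain (route-repair 2026-08-16, unused-crux): the SEPARATOR-WEGNER
COMPLETION of the hinge, NegativeCellsDilute → CoerciveSea. Given windowed local dilution (ii) + the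
parity pin (iii) for an admissible regularisation — the tier-deciding crux NegativeCellsDilute
(stmt-QuantumFields-13900), reached from THE LINE EarlyCrosserLaw (stmt-13995) by the proved
supports DiluteOfEarlyCrossers and SignDefectForcesCrossing — supply clause (i), the separator
Wegner law in the window (P(HasSingularSeparator U m_f(k) s (t/s₀)) ≤ C t^α for roughly cubic
corner-0 window boxes, uniformly in k, volume and box) ALONG A REGULARISATION THAT ALSO CARRIES
(ii),(iii), i.e. conclude CoerciveSea (stmt-13901). Role: with this item the cone of `closes`
(hypothesis CoerciveSea) reaches NegativeCellsDilute and, through DiluteOfEarlyCrossers,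
EarlyCrosserLaw, so proving the rank-2 cruxes advances the deciding theorem (CoerciveSea derived via
CoerciveOfDilute). Content and size: crux-grade — it is exactly CoerciveSea (i) (why it might fail:
typical lowest separator singular value ≍ c₁/s; the law needs the gauge-noise fluctuations at scales
≤ ℓ to be large deviations — false if the -/
@[route_item "route-QuantumFields-NestedDissectionSea"]
def CoerciveOfDilute : Prop :=
  NegativeCellsDilute → CoerciveSea

-- earlier Assembly (stmt-QuantumFields-11277, replaced 2026-08-15T22:44:21Z -> stmt-QuantumFields-13881): retired by None — CoerciveSea → SeaFactorisationBridge → ThresholdShift → QCD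
-- earlier Assembly (stmt-QuantumFields-13881, replaced 2026-08-16T23:27:11Z -> stmt-QuantumFields-17684): proved by Summit.QuantumFields.QCD.Theorems.NestedDissectionSea.assembly_proof @ 55916e61de1d — RobustYangMills → CoerciveSea → SeaFactorisationBridge → ThresholdShift → QCD
-- earlier Assembly (stmt-QuantumFields-16993, replaced 2026-08-17T01:01:46Z -> stmt-QuantumFields-17011): retired by None — RobustYangMillsRG → EarlyCrosserLaw → SignDefectForcesCrossing → CoerciveOfDilute → SeaFactorisationBridge → LightQuarkCompletion → QCD
-- earlier Assembly (stmt-QuantumFields-17684, replaced 2026-08-16T23:28:06Z -> stmt-QuantumFields-17704): retired by None — CoerciveSea → SeaFactorisationBridge → QCD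
-- earlier Assembly (stmt-QuantumFields-17704, replaced 2026-08-17T00:05:39Z -> stmt-QuantumFields-18067): proved by Summit.QuantumFields.QCD.Theorems.NestedDissectionSea.assembly_proof @ c0d06a1d27d7 — RobustYangMillsRG → EarlyCrosserLaw → SignDefectForcesCrossing → DiluteOfEarlyCrossers → CoerciveOfDilute → SeaFactorisationBridge → JumpLineIsChiral → QCD
-- earlier Assembly (stmt-QuantumFields-18067, replaced 2026-08-17T00:56:50Z -> stmt-QuantumFields-16993): proved by Summit.QuantumFields.QCD.Theorems.NestedDissectionSea.assembly_proof @ d9b3df30b6b3 — RobustYangMillsRG → EarlyCrosserLaw → SignDefectForcesCrossing → DiluteOfEarlyCrossers → CoerciveOfDilute → SeaFactorisationBridge → LightQuarkCompletion → QCD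
/-- item stmt-QuantumFields-17011 · assembly · rank 1 · closed · proved by Summit.QuantumFields.QCD.Theorems.NestedDissectionSea.assembly_proof @ 29524c863bf4 (prover) · by planner
sources: JaffeWitten2000, MontvayMunster1994
[assembly] RobustYangMillsRG → EarlyCrosserLaw → FrameAndSeparatorLaw → SeaFactorisationBridge →
LightQuarkCompletion → QCD — the deciding chain after the route-repair of 2026-08-17 (crux-attack
rattack-18065): the THRESHOLD bridge is fed BY NAME with RG-level robust SU(3) Yang–Mills, THE LINE
(its own two-sided-pinned early-crosser-dilute regularisation) and the frame ∧ separator law along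
pinned-dilute lines ((α) frames that regularisation on the physical branch, (β) makes it coercive),
and returns one admissible regularisation with a threshold M₀, the two-sided parity pin and the
QCDOf body above M₀; the light-quark node (= ZeroThresholdDescent ∧ JumpLineIsChiral) makes it a
branch regularisation pinned at zero threshold, chiral at zero, with the body at every positive
mass; QCD = QCDOf 2 ∧ QCDOf 3. Verbatim the type of `closes` (pure logic, std axioms), so `unfold
Assembly; exact closes` proves it exactly as Theorems/NestedDissectionSeaAssembly.lean proved revs
11, 26 and 29; supersedes the interim chain of rev 31. [difficulty: provable-now] -/
@[route_item "route-QuantumFields-NestedDissectionSea"]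
def Assembly : Prop :=
  RobustYangMillsRG → EarlyCrosserLaw → FrameAndSeparatorLaw → SeaFactorisationBridge → LightQuarkCompletion → QCD

-- records of items no longer active in this route (dropped / restated):
-- earlier DiluteOfEarlyCrossers (stmt-QuantumFields-13979, dropped 2026-08-17T00:56:50Z): proved by Summit.QuantumFields.QCD.Theorems.diluteOfEarlyCrossers_proof @ f8f59edf6c93 — EarlyCrosserLaw → SignDefectForcesCrossing → NegativeCellsDilute
-- earlier JumpLineIsChiral (stmt-QuantumFields-17706, replaced 2026-08-17T00:05:39Z -> stmt-QuantumFields-18066): retired by None — open Literature.MathematicalPhysics.QuantumLattice Literature.MathematicalPhysics.QuantumFieldTheory Literature.Probability.LatticeModels in ∀ Nf : ℕ, (Nf = 2 ∨ Nf = 3) → ∀ reg : QCDRegularisation Nf, reg.HasMassScaling → (reg.scheme 0 0 0).HasAsymptoticScaling → Filter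
-- earlier ThresholdShift (stmt-QuantumFields-8699, dropped 2026-08-16T23:27:11Z): proved by Summit.QuantumFields.QCD.Theorems.thresholdShift_proof — ∀ (Nf : ℕ) (reg : Literature.MathematicalPhysics.QuantumFieldTheory.QCDRegularisation Nf) (M₀ : ℝ), ∃ reg' : Literature.MathematicalPhysics.QuantumFieldTheory.QCDRegularisation Nf, (reg.HasMassScaling → reg'.HasMassScaling) ∧ ∀ (m : Fin Nf → ℝ) (z shift

/-! D-0027 §2.1 — DECIDING THEOREM (planner-authored via `route open/edit --closes-file`; by planner-rrefute-QuantumFields-NestedDissection-4647e636-0 2026-08-17T01:01:46Z):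
its hypotheses are this route's items and its conclusion the sub-problem Statement (glue_lint), and it elaborates with this file. -/

/-- D-0027 §2.1 deciding theorem (route-repair 2026-08-17 on the crux-attack rattack-18065, 'missing frame on hypothesis 2';
before it rattack-17705 and the `QCDOf` re-type `IsChiralAtZero`): the THRESHOLD bridge `SeaFactorisationBridge` (crux, restated
over FRAMED BY-NAME hypotheses) is fed with the RG-level robust Yang–Mills input `RobustYangMillsRG` (crux, shared), THE LINE
`EarlyCrosserLaw` (crux — its own two-sided-pinned, early-crosser-dilute admissible regularisation IS the output regularisation)
and `FrameAndSeparatorLaw` (crux, new — (α) a two-sided parity pin forces `m_crit → 0`, framing that regularisation on the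
physical branch; (β) the separator Wegner law along every physical-branch pinned-dilute regularisation makes it coercive), and
returns for `N_f = 2, 3` ONE admissible regularisation with a threshold `M₀ ≥ 0`, the two-sided parity pin above `M₀` and the
`QCDOf` body above `M₀`; the light-quark node `LightQuarkCompletion` (crux; = `ZeroThresholdDescent ∧ JumpLineIsChiral` by its
foreseen glue) turns it into a regularisation on the physical branch pinned at zero threshold, CHIRAL AT ZERO and carrying the
body at EVERY positive mass tuple — literally the witness of the re-typed `QCDOf N_f`; `QCD = QCDOf 2 ∧ QCDOf 3`. Every binder
is a crux and every binder is used. Pure logic. -/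
@[closes "route-QuantumFields-NestedDissectionSea"] theorem closes : RobustYangMillsRG → EarlyCrosserLaw → FrameAndSeparatorLaw → SeaFactorisationBridge → LightQuarkCompletion → QCD := by
  intro hY hE hF hB hL
  have h := hB hY hE hF
  have key : ∀ Nf : ℕ, (Nf = 2 ∨ Nf = 3) → QCDOf Nf := by
    intro Nf hNf
    obtain ⟨reg, hms, haf, hbr, M₀, hM₀, hpin, hbody⟩ := h Nf hNf
    obtain ⟨reg', hms', -, -, -, hchi, hbody'⟩ := hL Nf hNf reg hms haf hbr M₀ hM₀ hpin hbody
    exact ⟨reg', hms', hchi, hbody'⟩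
  exact ⟨key 2 (Or.inl rfl), key 3 (Or.inr rfl)⟩

end Summit.QuantumFields.QCD.Theses.NestedDissectionSea
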